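/-
Planner work file (lens «barrier inversion» at crux level, generation 19) for the crux
`KrwChromaticSteering.StrongComposition` (C1, stmt-PneNP-18538), route `route-PneNP-KrwChromaticSteering`.
Seat pnp-ideate-p4 (g19), 2026-08-29.  Sorry-free.  Published with
`ledger crux write stmt-PneNP-18538 LensBarrierP4g19.lean`.
FRONTIER (formula-depth / KRW rung); nothing here bears on P vs NP.
-/
import Mathlib
import Summits.PneNP.PneNP.Theses.KrwChromaticSteering
import Literature.Computability.Complexity.KRWComposition
import Literature.Computability.Complexity.KWDepthHardFunctions

/-!
# Barrier lens on `StrongComposition` (C1), generation 19: what the merge of M3 (label ∨ public-row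
tests, p5 g17) and L⁺ (label ∨ affine tests, p4 g18) actually needs — same-side splits are cheap,
joint label–row parities are synthesised inside class LRA, and the disciplined sub-class is typed

Context.  g18 typed the next rung `P4g18.StrongCompositionLRA` (C1 for protocols whose node tests are
label tests ∨ single-row tests ∨ affine tests) and left ONE open point: what an affine equation
through a half-played row costs.  This file records, kernel-checked, the three facts the analysis of
that point rests on (memo `LensBarrierP4g19.md`):

* §1 `sameSide_split` / `sameCoord_split` / `sameParity_split` (generic coordinates `ι`).  If a KW
  rectangle `A × B` needs depth `ℓ` and the two MIXED sub-rectangles cut by a bit `p`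
  (`p(a) = γ`, `p(b) = ¬γ`) are solvable in depth `≤ d`, then for some `γ` the SAME-SIDE rectangle
  `(A ∩ p = γ) × (B ∩ p = γ)` still needs depth `ℓ − 2`, provided `ℓ ≥ d + 3` (glue the four trees
  under "Alice says `p`, Bob says `p`": `exchange`).  For a coordinate bit `d = 0` (the mixed parts are
  solved by a leaf); for a parity bit on a support of size `≤ 2^k`, `d = 2k` by the binary parity
  search `psearch` (§1, `psearch_solves`, `depth_psearch`).  CONSEQUENCE: an adversary can keep an
  answered parity COMMON to both players (no one-sided channel) at cost two, not one-per-side-with-a-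
  fork, as long as the rectangle is harder than `2⌈log₂ n⌉ + 3`; and it can equalise a label
  coordinate (`a_i = b_i`, killing row `i` as an output row) at cost two whenever `ℓ ≥ 3`.
* §1 (size version) `SizeHard`, `sizeSameSide_split`, `sizeSameCoord_split`, `sizeSameCoord_half`,
  `sizeOneSided_split`: with protocol-SIZE hardness of the label rectangle a same-side split of a coordinate
  keeps `(L − 1)/2` leaves — ONE bit of `log₂ L` instead of the two depth units of `sameCoord_split` — and
  one-sided splits stay sub-additive; this is the checked inequality behind the size-credit lead (memo §6).
* §2 `phase2_private`.  The collapse phase of the L⁺ adversary (`P4g18.phase2`) never needed the two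
  players to use the SAME label-indexed family of matrices: private families `F_A`, `F_B` realising the
  labels suffice (violation by equal labels in the output row).  So commonality of the affine system is
  needed only for the ENTRY half of the violation, never for the label half.
* §3 `jointBit_synthesis` + the typed classes.  Inside class LRA two legal tests — the 2-row affine test
  `u(X_i) ⊕ u'(X_{i'})` and the single-row test `u(X_i) ⊕ g(X_i)` — determine the MIXED label–entry parity
  `g(X_i) ⊕ u'(X_{i'}) = a_i ⊕ u'(X_{i'})`, which is neither a label test nor a row test nor affine.  So K2
  (`StrongCompositionLRA`) already contains, at depth factor 2, the mixed tests of the class LAM typed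
  here (`IsMixedTest`, `LabelAffineMixed`, `StrongCompositionLAM`: node tests `φ(a) ⊕ ⨁_{p∈S} X_p`).  A
  mixed bit is absorbed label-freely by a fibrewise-affine adversary state, but leaves a TWIST DEBT on its
  label coordinates (memo §2): the other player's counterpart answer must anticipate `a_i ⊕ b_i`; a wrong
  twist hands the protocol the coupled row by the parity search of §1 (`psearch`, `2⌈log₂ n⌉` bits), a
  right one needs control of `a_i ⊕ b_i` — free at an unforced label split, else two units of `ℓ`
  (`sameCoord_split`).  The rung WITHOUT debts is typed here: `LRADisciplined` (along every root–leaf path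
  no row carries both a row test and an affine test; rows typed `algebraic`/`combinatorial` online) and
  `StrongCompositionLRAD` = C1 restricted to it, with `lrad_of_strongComposition : C1 → it`,
  `lrad_of_lra : K2 → it`, and the inclusions `LabelAffine.lraDisciplinedOn`, `LabelPublic.lraDisciplinedOn`
  showing it contains BOTH proved classes (M3 and L⁺).  Its proof is the product of the two existing
  adversaries (memo §5 gives the gluing recipe); it is NOT proved in this file.

* §5 `PerRowLU`, `PerRowLUOfGeneric`, **`perRowLUOfGeneric_holds`** (support statement S3, PROVED): label-
  universality with a budget of `n − r − 1` parity equations PER ROW instead of L⁺'s single global budget —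
  what a merged adversary that charges equations to rows and takes a minimum over rows needs (memo §3,
  §5); proof = g18's row surgery applied to the equations touching the row being re-chosen.
* §6 **`jointHardGeneric_exists`** (support statement S0, PROVED): for every `n ≥ 1` ONE non-constant
  `g : {0,1}^n → {0,1}` that is `2 (log₂ n + 1)`-affine-generic (L⁺'s hypothesis) AND has Karchmer–Wigderson
  depth `≥ n − 8 (log₂ n + 1)` (M3's hypothesis) — the two counting arguments of the tree made quantitative
  (`card_code_lt_two_pow_two_pow_pred`: `#Code < 2^{2^{n−1}}`; `exists_affBad`: `≤ 2^{2^n − 1}` degenerate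
  functions) and added.  With §5 this discharges every SUPPORT statement of the LRAD recipe (memo §5) except
  the gluing itself; S1 (`sat_setRow_of_touching`) and S2 (`exists_X_fibred`, the `E`-fibred form of M3's
  `exists_X_row`) are proved in §5 as well.
* §7 `LRADQuantitative` (the ONE remaining stub: the adversary bound `ℓ + min(dg, q−1) ≤ P.depth + 2` on
  disciplined protocols) and **`strongCompositionLRAD_of_quantitative : LRADQuantitative → StrongCompositionLRAD`**
  (PROVED): the rung is now a one-stub skeleton whose composition and every support statement are checked.

Nothing here bears on `P ≠ NP`; C1 itself stays open.
-/

set_option linter.dupNamespace false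
set_option autoImplicit false

namespace Summit.PneNP.PneNP.Cruxes.StrongComposition.P4g19

open Literature.Computability.Complexity

universe u

/-! ## §0  Rectangle vocabulary of p5 g17 (`LensNegationP5g17.lean` §1), restated VERBATIM
(crux workfiles downstream of the disprover's `Disproof.lean` are not importable between world builds;
the three declarations read identically against `LabelPublic.SolvesRect`, `LabelPublic.Hard`,
`LabelPublic.Hard.of_le`). -/

section Rect

variable {ι : Type u}

/-- [verbatim `LabelPublic.SolvesRect`] the tree `Q` solves the KW game on the rectangle `A × B`. -/
def SolvesRect (Q : KWTree ι) (A B : Set (ι → Bool)) : Prop :=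
  ∀ a ∈ A, ∀ b ∈ B, a (Q.run a b) ≠ b (Q.run a b)

/-- [verbatim `LabelPublic.Hard`] every tree solving `A × B` has depth `≥ ℓ`. -/
def Hard (A B : Set (ι → Bool)) (ℓ : ℕ) : Prop :=
  ∀ Q : KWTree ι, SolvesRect Q A B → ℓ ≤ Q.depth

theorem Hard.of_le {A B : Set (ι → Bool)} {ℓ ℓ' : ℕ} (h : Hard A B ℓ) (hℓ : ℓ' ≤ ℓ) : Hard A B ℓ' :=
  fun Q hQ => hℓ.trans (h Q hQ)

end Rect

/-! ## §1  Same-side splits are cheap above the mixed-game threshold -/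

section SameSide

variable {ι : Type u}

/-- "Alice announces `p a`, Bob announces `p b`", then one of four continuations `Q_{p a, p b}`. -/
def exchange (p : (ι → Bool) → Bool) (Q₀₀ Q₀₁ Q₁₀ Q₁₁ : KWTree ι) : KWTree ι :=
  KWTree.alice p (KWTree.bob p Q₀₀ Q₀₁) (KWTree.bob p Q₁₀ Q₁₁)

theorem depth_exchange (p : (ι → Bool) → Bool) (Q₀₀ Q₀₁ Q₁₀ Q₁₁ : KWTree ι) {D : ℕ}
    (h₀₀ : Q₀₀.depth ≤ D) (h₀₁ : Q₀₁.depth ≤ D) (h₁₀ : Q₁₀.depth ≤ D) (h₁₁ : Q₁₁.depth ≤ D) :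
    (exchange p Q₀₀ Q₀₁ Q₁₀ Q₁₁).depth ≤ D + 2 := by
  simp only [exchange, KWTree.depth_alice, KWTree.depth_bob]
  omega

theorem run_exchange (p : (ι → Bool) → Bool) (Q₀₀ Q₀₁ Q₁₀ Q₁₁ : KWTree ι) (a b : ι → Bool) :
    (exchange p Q₀₀ Q₀₁ Q₁₀ Q₁₁).run a b =
      if p a then (if p b then Q₁₁.run a b else Q₁₀.run a b)
      else (if p b then Q₀₁.run a b else Q₀₀.run a b) := by
  simp only [exchange, KWTree.run_alice, KWTree.run_bob]

/-- The four-way gluing solves `A × B` if `Q_{γδ}` solves `(A ∩ p = γ) × (B ∩ p = δ)`. -/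
theorem solvesRect_exchange {p : (ι → Bool) → Bool} {Q₀₀ Q₀₁ Q₁₀ Q₁₁ : KWTree ι} {A B : Set (ι → Bool)}
    (h₀₀ : SolvesRect Q₀₀ (A ∩ {a | p a = false}) (B ∩ {b | p b = false}))
    (h₀₁ : SolvesRect Q₀₁ (A ∩ {a | p a = false}) (B ∩ {b | p b = true}))
    (h₁₀ : SolvesRect Q₁₀ (A ∩ {a | p a = true}) (B ∩ {b | p b = false}))
    (h₁₁ : SolvesRect Q₁₁ (A ∩ {a | p a = true}) (B ∩ {b | p b = true})) :
    SolvesRect (exchange p Q₀₀ Q₀₁ Q₁₀ Q₁₁) A B := by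
  intro a ha b hb
  rw [run_exchange]
  cases hpa : p a <;> cases hpb : p b <;> simp only [Bool.false_eq_true, ↓reduceIte]
  · exact h₀₀ a ⟨ha, hpa⟩ b ⟨hb, hpb⟩
  · exact h₀₁ a ⟨ha, hpa⟩ b ⟨hb, hpb⟩
  · exact h₁₀ a ⟨ha, hpa⟩ b ⟨hb, hpb⟩
  · exact h₁₁ a ⟨ha, hpa⟩ b ⟨hb, hpb⟩

/-- **Same-side split.**  If `A × B` needs depth `ℓ ≥ d + 3` and both MIXED rectangles
`(A ∩ p = γ) × (B ∩ p = ¬γ)` are solvable in depth `≤ d`, then some SAME-SIDE rectangle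
`(A ∩ p = γ) × (B ∩ p = γ)` still needs depth `ℓ − 2`. -/
theorem sameSide_split {A B : Set (ι → Bool)} {ℓ d : ℕ} (h : Hard A B ℓ) (p : (ι → Bool) → Bool)
    (hmix : ∀ γ : Bool, ∃ Q : KWTree ι,
      SolvesRect Q (A ∩ {a | p a = γ}) (B ∩ {b | p b = !γ}) ∧ Q.depth ≤ d)
    (hℓ : d + 3 ≤ ℓ) :
    ∃ γ : Bool, Hard (A ∩ {a | p a = γ}) (B ∩ {b | p b = γ}) (ℓ - 2) := by
  classical
  by_contra hcon
  push Not at hcon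
  have h0 := hcon false
  have h1 := hcon true
  simp only [Hard, not_forall, not_le] at h0 h1
  obtain ⟨Q₀₀, hQ₀₀, hd₀₀⟩ := h0
  obtain ⟨Q₁₁, hQ₁₁, hd₁₁⟩ := h1
  obtain ⟨Q₀₁, hQ₀₁, hd₀₁⟩ := hmix false
  obtain ⟨Q₁₀, hQ₁₀, hd₁₀⟩ := hmix true
  have hsol : SolvesRect (exchange p Q₀₀ Q₀₁ Q₁₀ Q₁₁) A B :=
    solvesRect_exchange hQ₀₀ (by simpa using hQ₀₁) (by simpa using hQ₁₀) hQ₁₁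
  have hdep : (exchange p Q₀₀ Q₀₁ Q₁₀ Q₁₁).depth ≤ (ℓ - 3) + 2 :=
    depth_exchange p Q₀₀ Q₀₁ Q₁₀ Q₁₁ (by omega) (by omega) (by omega) (by omega)
  have := h _ hsol
  omega

/-- **Same-coordinate split** (`d = 0`: the mixed parts are solved by the leaf `i`).  Equalising a
label coordinate costs at most two: if `A × B` needs depth `ℓ ≥ 3` then some `(A ∩ a_i = γ) × (B ∩ b_i = γ)`
needs depth `ℓ − 2`. -/
theorem sameCoord_split {A B : Set (ι → Bool)} {ℓ : ℕ} (h : Hard A B ℓ) (i : ι) (hℓ : 3 ≤ ℓ) :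
    ∃ γ : Bool, Hard (A ∩ {a | a i = γ}) (B ∩ {b | b i = γ}) (ℓ - 2) := by
  refine sameSide_split (d := 0) h (fun a => a i) (fun γ => ⟨KWTree.leaf i, ?_, by simp⟩) (by omega)
  intro a ha b hb
  simp only [KWTree.run_leaf]
  rw [ha.2, hb.2]
  cases γ <;> decide

/-! ### Binary parity search: the mixed rectangles of a parity bit are `2⌈log₂ |support|⌉`-easy -/

/-- Parity of `x` over the coordinates listed in `L` (with multiplicity). -/
def lpar (L : List ι) (x : ι → Bool) : Bool := Nat.bodd (L.countP fun i => x i = true)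

theorem lpar_nil (x : ι → Bool) : lpar ([] : List ι) x = false := by
  simp [lpar]

theorem lpar_append (L₁ L₂ : List ι) (x : ι → Bool) :
    lpar (L₁ ++ L₂) x = Bool.xor (lpar L₁ x) (lpar L₂ x) := by
  simp [lpar, List.countP_append, Nat.bodd_add]

theorem lpar_singleton (i : ι) (x : ι → Bool) : lpar [i] x = x i := by
  unfold lpar
  cases h : x i <;> simp [h]

/-- Binary search for a coordinate where two strings of DIFFERENT `L`-parity differ: Alice and Bob
exchange the parity of the first half; recurse on the first half if those differ, else on the second.
`k` is the fuel (number of halvings), `d` a default coordinate for the degenerate empty list. -/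
def psearch (d : ι) : ℕ → List ι → KWTree ι
  | 0, L => KWTree.leaf (L.headD d)
  | k + 1, L =>
      exchange (lpar (L.take (L.length / 2)))
        (psearch d k (L.drop (L.length / 2))) (psearch d k (L.take (L.length / 2)))
        (psearch d k (L.take (L.length / 2))) (psearch d k (L.drop (L.length / 2)))

theorem depth_psearch (d : ι) : ∀ (k : ℕ) (L : List ι), (psearch d k L).depth ≤ 2 * k
  | 0, L => by simp [psearch]
  | k + 1, L => by
    have h₁ := depth_psearch d k (L.take (L.length / 2))
    have h₂ := depth_psearch d k (L.drop (L.length / 2))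
    have := depth_exchange (lpar (L.take (L.length / 2))) _ _ _ _ h₂ h₁ h₁ h₂
    simp only [psearch]
    omega

/-- Correctness of the parity search: on strings of different `L`-parity with `|L| ≤ 2^k` it outputs a
coordinate where they differ. -/
theorem psearch_correct (d : ι) : ∀ (k : ℕ) (L : List ι) (x y : ι → Bool),
    L.length ≤ 2 ^ k → lpar L x ≠ lpar L y →
      x ((psearch d k L).run x y) ≠ y ((psearch d k L).run x y)
  | 0, L, x, y, hL, hne => by
    match L, hL, hne with
    | [], _, hne => simp [lpar_nil] at hne
    | [i], _, hne =>
      simp only [psearch, List.headD_cons, KWTree.run_leaf]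
      simpa [lpar_singleton] using hne
    | i :: j :: L', hL, _ => simp at hL
  | k + 1, L, x, y, hL, hne => by
    set h := L.length / 2 with hh
    have hsplit : L = L.take h ++ L.drop h := (List.take_append_drop h L).symm
    have hlen₁ : (L.take h).length ≤ 2 ^ k := by
      simp only [List.length_take]
      have : 2 ^ (k + 1) = 2 * 2 ^ k := by ring
      omega
    have hlen₂ : (L.drop h).length ≤ 2 ^ k := by
      simp only [List.length_drop]
      have : 2 ^ (k + 1) = 2 * 2 ^ k := by ring
      omega
    have hpar : Bool.xor (lpar (L.take h) x) (lpar (L.drop h) x) ≠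
        Bool.xor (lpar (L.take h) y) (lpar (L.drop h) y) := by
      rw [← lpar_append, ← lpar_append, ← hsplit]
      exact hne
    simp only [psearch, ← hh]
    rw [run_exchange]
    cases hx : lpar (L.take h) x <;> cases hy : lpar (L.take h) y <;>
      simp only [Bool.false_eq_true, ↓reduceIte]
    · -- equal first-half parities: second halves differ
      refine psearch_correct d k (L.drop h) x y hlen₂ ?_
      rw [hx, hy] at hpar
      simpa using hpar
    · exact psearch_correct d k (L.take h) x y hlen₁ (by rw [hx, hy]; decide)
    · exact psearch_correct d k (L.take h) x y hlen₁ (by rw [hx, hy]; decide)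
    · refine psearch_correct d k (L.drop h) x y hlen₂ ?_
      rw [hx, hy] at hpar
      simpa using hpar

/-- The parity search solves the mixed rectangle of the parity bit `lpar L`. -/
theorem psearch_solves (d : ι) (k : ℕ) (L : List ι) (hL : L.length ≤ 2 ^ k) (γ : Bool)
    (A B : Set (ι → Bool)) :
    SolvesRect (psearch d k L) (A ∩ {a | lpar L a = γ}) (B ∩ {b | lpar L b = !γ}) := by
  intro a ha b hb
  refine psearch_correct d k L a b hL ?_
  rw [ha.2, hb.2]
  cases γ <;> decide

/-- **Same-parity split.**  Keeping an answered parity COMMON to both players costs at most two above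
the threshold `2k + 3` (`|support| ≤ 2^k`): if `A × B` needs depth `ℓ ≥ 2k + 3` then some
`(A ∩ ⊕_L a = γ) × (B ∩ ⊕_L b = γ)` needs depth `ℓ − 2`. -/
theorem sameParity_split {A B : Set (ι → Bool)} {ℓ k : ℕ} (h : Hard A B ℓ) (d : ι) (L : List ι)
    (hL : L.length ≤ 2 ^ k) (hℓ : 2 * k + 3 ≤ ℓ) :
    ∃ γ : Bool, Hard (A ∩ {a | lpar L a = γ}) (B ∩ {b | lpar L b = γ}) (ℓ - 2) :=
  sameSide_split (d := 2 * k) h (lpar L)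
    (fun γ => ⟨psearch d k L, psearch_solves d k L hL γ A B, depth_psearch d k L⟩) hℓ

/-- Below the threshold nothing is claimed, and nothing is needed: a rectangle of hardness
`≤ 2k + 2` contributes only `O(log n)` to any potential.  Recorded as the trivial bound used by the
memo's accounting (`Hard` is antitone in the bound). -/
theorem hard_of_le_threshold {A B : Set (ι → Bool)} {ℓ t : ℕ} (h : Hard A B ℓ) (ht : t ≤ ℓ) :
    Hard A B t := h.of_le ht

/-! ### Size version: with protocol-SIZE hardness a same-side split costs ONE bit, not two (memo §6)

`SizeHard A B L`: every tree solving `A × B` has at least `L` leaves.  Gluing under "Alice says `p a`, Bob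
says `p b`" ADDS leaf counts instead of taking a maximum plus two, so when the mixed rectangles are
solved by `c₀₁ + c₁₀` leaves the two same-side rectangles need `L₀ + L₁ ≥ L + 1 − c₀₁ − c₁₀` leaves
between them: for a coordinate (`c = 1 + 1`) the better same-side quadrant keeps `≥ (L − 1)/2` leaves,
a drop of ONE in `log₂`.  This is the inequality behind the size-hardness lead of memo §6. -/

/-- Every tree solving `A × B` has at least `L` leaves. -/
def SizeHard (A B : Set (ι → Bool)) (L : ℕ) : Prop :=
  ∀ Q : KWTree ι, SolvesRect Q A B → L ≤ Q.leafCount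

theorem SizeHard.of_le {A B : Set (ι → Bool)} {L L' : ℕ} (h : SizeHard A B L) (hL : L' ≤ L) :
    SizeHard A B L' :=
  fun Q hQ => hL.trans (h Q hQ)

theorem leafCount_exchange (p : (ι → Bool) → Bool) (Q₀₀ Q₀₁ Q₁₀ Q₁₁ : KWTree ι) :
    (exchange p Q₀₀ Q₀₁ Q₁₀ Q₁₁).leafCount =
      Q₀₀.leafCount + Q₀₁.leafCount + (Q₁₀.leafCount + Q₁₁.leafCount) := by
  simp only [exchange, KWTree.leafCount_alice, KWTree.leafCount_bob]

/-- **Same-side split, size version.**  If `A × B` needs `L` leaves and the mixed rectangles are solved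
with `c₀₁`, `c₁₀` leaves, then for any split `L₀ + L₁ + c₀₁ + c₁₀ ≤ L + 1` of the budget one of the
same-side rectangles needs `L₀` resp. `L₁` leaves. -/
theorem sizeSameSide_split {A B : Set (ι → Bool)} {L L₀ L₁ c₀₁ c₁₀ : ℕ} (h : SizeHard A B L)
    (p : (ι → Bool) → Bool)
    (h₀₁ : ∃ Q : KWTree ι, SolvesRect Q (A ∩ {a | p a = false}) (B ∩ {b | p b = true}) ∧ Q.leafCount ≤ c₀₁)
    (h₁₀ : ∃ Q : KWTree ι, SolvesRect Q (A ∩ {a | p a = true}) (B ∩ {b | p b = false}) ∧ Q.leafCount ≤ c₁₀)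
    (hL : L₀ + L₁ + c₀₁ + c₁₀ ≤ L + 1) :
    SizeHard (A ∩ {a | p a = false}) (B ∩ {b | p b = false}) L₀ ∨
      SizeHard (A ∩ {a | p a = true}) (B ∩ {b | p b = true}) L₁ := by
  classical
  by_contra hcon
  push Not at hcon
  obtain ⟨h0, h1⟩ := hcon
  simp only [SizeHard, not_forall, not_le] at h0 h1
  obtain ⟨Q₀₀, hQ₀₀, hd₀₀⟩ := h0
  obtain ⟨Q₁₁, hQ₁₁, hd₁₁⟩ := h1
  obtain ⟨Q₀₁, hQ₀₁, hd₀₁⟩ := h₀₁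
  obtain ⟨Q₁₀, hQ₁₀, hd₁₀⟩ := h₁₀
  have hsol : SolvesRect (exchange p Q₀₀ Q₀₁ Q₁₀ Q₁₁) A B :=
    solvesRect_exchange hQ₀₀ hQ₀₁ hQ₁₀ hQ₁₁
  have hcnt := leafCount_exchange p Q₀₀ Q₀₁ Q₁₀ Q₁₁
  have := h _ hsol
  omega

/-- **Same-coordinate split, size version**: equalising a label coordinate costs ONE bit of `log₂ L`:
if `A × B` needs `L` leaves and `L₀ + L₁ + 1 ≤ L`, then `(A ∩ a_i = 0) × (B ∩ b_i = 0)` needs `L₀` leaves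
or `(A ∩ a_i = 1) × (B ∩ b_i = 1)` needs `L₁` (take `L₀ = L₁ = (L − 1)/2`).  Compare `sameCoord_split`
(depth version: `ℓ − 2`). -/
theorem sizeSameCoord_split {A B : Set (ι → Bool)} {L L₀ L₁ : ℕ} (h : SizeHard A B L) (i : ι)
    (hL : L₀ + L₁ + 1 ≤ L) :
    SizeHard (A ∩ {a | a i = false}) (B ∩ {b | b i = false}) L₀ ∨
      SizeHard (A ∩ {a | a i = true}) (B ∩ {b | b i = true}) L₁ := by
  refine sizeSameSide_split (c₀₁ := 1) (c₁₀ := 1) h (fun a => a i)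
    ⟨KWTree.leaf i, ?_, by simp⟩ ⟨KWTree.leaf i, ?_, by simp⟩ (by omega)
  · intro a ha b hb
    simp only [KWTree.run_leaf]
    rw [ha.2, hb.2]
    decide
  · intro a ha b hb
    simp only [KWTree.run_leaf]
    rw [ha.2, hb.2]
    decide

/-- The halving form: some same-side quadrant of coordinate `i` keeps `(L − 1) / 2` leaves of hardness. -/
theorem sizeSameCoord_half {A B : Set (ι → Bool)} {L : ℕ} (h : SizeHard A B L) (i : ι) :
    ∃ γ : Bool, SizeHard (A ∩ {a | a i = γ}) (B ∩ {b | b i = γ}) ((L - 1) / 2) := by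
  rcases Nat.lt_or_ge L 1 with hL | hL
  · exact ⟨false, fun Q _ => by omega⟩
  · rcases sizeSameCoord_split (L₀ := (L - 1) / 2) (L₁ := (L - 1) / 2) h i (by omega) with h0 | h1
    · exact ⟨false, h0⟩
    · exact ⟨true, h1⟩

/-- One-sided splits are sub-additive in size (the label step and M3's commitment step survive with size
credit): if `A × B` needs `L` leaves then for every `L₀ + L₁ ≤ L + 1` one half `(A ∩ p = γ) × B` needs
`L₀` resp. `L₁` leaves (so the better half keeps `≥ L / 2`). -/
theorem sizeOneSided_split {A B : Set (ι → Bool)} {L L₀ L₁ : ℕ} (h : SizeHard A B L)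
    (p : (ι → Bool) → Bool) (hL : L₀ + L₁ ≤ L + 1) :
    SizeHard (A ∩ {a | p a = false}) B L₀ ∨ SizeHard (A ∩ {a | p a = true}) B L₁ := by
  classical
  by_contra hcon
  push Not at hcon
  obtain ⟨h0, h1⟩ := hcon
  simp only [SizeHard, not_forall, not_le] at h0 h1
  obtain ⟨Q₀, hQ₀, hd₀⟩ := h0
  obtain ⟨Q₁, hQ₁, hd₁⟩ := h1
  have hsol : SolvesRect (KWTree.alice p Q₀ Q₁) A B := by
    intro a ha b hb
    simp only [KWTree.run_alice]
    cases hpa : p a <;> simp only [Bool.false_eq_true, ↓reduceIte]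
    · exact hQ₀ a ⟨ha, hpa⟩ b hb
    · exact hQ₁ a ⟨ha, hpa⟩ b hb
  have := h _ hsol
  simp only [KWTree.leafCount_alice] at this
  omega

end SameSide

/-! ## §2  The collapse phase needs no common family: private label-indexed families suffice -/

section PrivateCollapse

variable {m n : ℕ}

/-- **Collapse with private families** (generalises `P4g18.phase2`, which is the case `F_A = F_B`).
If Alice realises every label vector `v` by a matrix `F_A v` and Bob by `F_B v` (labels exact), and the
label rectangle `A × B` needs `KW`-depth `ℓ`, then every tree of depth `< ℓ`, fed the realised
matrices, answers in a row where the two labels AGREE for some `(a, b) ∈ A × B` — a violation of the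
strong game whatever the entries are.  No relation between `F_A` and `F_B` is needed: commonality of
the players' constraint systems matters only for the ENTRY half of a violation, never for the label
half. -/
theorem phase2_private (g : (Fin n → Bool) → Bool)
    (FA FB : (Fin m → Bool) → (Fin m × Fin n → Bool))
    (hFA : ∀ v, rowLabels g (FA v) = v) (hFB : ∀ v, rowLabels g (FB v) = v)
    {A B : Set (Fin m → Bool)} {ℓ : ℕ} (hH : Hard A B ℓ)
    (P : KWTree (Fin m × Fin n)) (hP : P.depth < ℓ) :
    ∃ a ∈ A, ∃ b ∈ B,
      rowLabels g (FA a) (P.run (FA a) (FB b)).1 = rowLabels g (FB b) (P.run (FA a) (FB b)).1 := by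
  by_contra hcon
  push Not at hcon
  have hsol : SolvesRect (P.comap FA FB Prod.fst) A B := by
    intro a ha b hb
    rw [KWTree.run_comap]
    have h := hcon a ha b hb
    rw [hFA, hFB] at h
    exact h
  have := hH _ hsol
  rw [KWTree.depth_comap] at this
  omega

/-- The same with the conclusion phrased on the players' own constraint predicates `CA`, `CB`
(whatever they are — affine systems, row sets, pins): valid witnesses with equal labels in the output
row exist as soon as each player's constraints admit a label-exact private family. -/
theorem phase2_private' (g : (Fin n → Bool) → Bool) {CA CB : (Fin m × Fin n → Bool) → Prop}
    (FA FB : (Fin m → Bool) → (Fin m × Fin n → Bool))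
    (hFA : ∀ v, rowLabels g (FA v) = v) (hFB : ∀ v, rowLabels g (FB v) = v)
    (hCA : ∀ v, CA (FA v)) (hCB : ∀ v, CB (FB v))
    {A B : Set (Fin m → Bool)} {ℓ : ℕ} (hH : Hard A B ℓ)
    (P : KWTree (Fin m × Fin n)) (hP : P.depth < ℓ) :
    ∃ X Y, CA X ∧ CB Y ∧ rowLabels g X ∈ A ∧ rowLabels g Y ∈ B ∧
      rowLabels g X (P.run X Y).1 = rowLabels g Y (P.run X Y).1 := by
  obtain ⟨a, ha, b, hb, hab⟩ := phase2_private g FA FB hFA hFB hH P hP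
  exact ⟨FA a, FB b, hCA a, hCB b, by rw [hFA]; exact ha, by rw [hFB]; exact hb, hab⟩

end PrivateCollapse

/-! ## §3  Joint label–row parities are synthesised inside LRA; the disciplined class, typed -/

section Discipline

variable {m n : ℕ}

/-! ### Vocabulary of g18 (`LensBarrierP4g18.lean` §1, §4), restated VERBATIM.
Crux workfiles committed after the farm's last world build are not importable (`lean check` answers
`stale:unbuilt`), so — as for the g13/g14 vocabulary before — the eight declarations this section
relates to are restated word for word; every statement below reads identically against the originals
`P4g18.parityOn … P4g18.StrongCompositionLRA`. -/

/-- [verbatim `P4g18.parityOn`] Parity of the entries of `X` on the support `S ⊆ [m] × [n]`. -/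
def parityOn (S : Finset (Fin m × Fin n)) (X : Fin m × Fin n → Bool) : Bool :=
  Nat.bodd (S.filter fun p => X p = true).card

/-- [verbatim `P4g18.IsAffineTest`] `X ↦ c ⊕ ⨁_{p ∈ S} X p`. -/
def IsAffineTest (s : (Fin m × Fin n → Bool) → Bool) : Prop :=
  ∃ (S : Finset (Fin m × Fin n)) (c : Bool), ∀ X, s X = Bool.xor c (parityOn S X)

/-- [verbatim `P4g18.IsLabelTest`] a function of the own label vector only. -/
def IsLabelTest (g : (Fin n → Bool) → Bool) (s : (Fin m × Fin n → Bool) → Bool) : Prop :=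
  ∃ φ : (Fin m → Bool) → Bool, ∀ X, s X = φ (rowLabels g X)

/-- [verbatim `P4g18.IsRowTest`] a function of one own row `X_i`, `i` fixed at the node. -/
def IsRowTest (s : (Fin m × Fin n → Bool) → Bool) : Prop :=
  ∃ (i : Fin m) (ψ : (Fin n → Bool) → Bool), ∀ X, s X = ψ (row X i)

/-- [verbatim `P4g18.LabelAffine`] class L⁺: label tests ∨ affine tests. -/
def LabelAffine (g : (Fin n → Bool) → Bool) : KWTree (Fin m × Fin n) → Prop
  | .leaf _ => True
  | .alice s P Q => (IsLabelTest g s ∨ IsAffineTest s) ∧ LabelAffine g P ∧ LabelAffine g Q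
  | .bob s P Q => (IsLabelTest g s ∨ IsAffineTest s) ∧ LabelAffine g P ∧ LabelAffine g Q

/-- [verbatim `P4g18.StrongCompositionLabelAffine`] C1 restricted to L⁺ (PROVED in g18,
`P4g18.strongCompositionLabelAffine`). -/
def StrongCompositionLabelAffine : Prop :=
  ∃ c : ℕ, ∀ m n : ℕ, 1 ≤ n → ∀ f : (Fin m → Bool) → Bool, (∃ a b, f a ≠ f b) →
    ∃ g : (Fin n → Bool) → Bool, ∀ P : KWTree (Fin m × Fin n), LabelAffine g P → P.SolvesStrong f g →
      ∃ Q : KWTree (Fin m), Q.Solves f ∧ Q.depth + n ≤ P.depth + c * (Nat.log 2 (m * n) + 1)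

/-- [verbatim `P4g18.LabelRowAffine`] class LRA: label ∨ public-row ∨ affine tests. -/
def LabelRowAffine (g : (Fin n → Bool) → Bool) : KWTree (Fin m × Fin n) → Prop
  | .leaf _ => True
  | .alice s P Q => (IsLabelTest g s ∨ IsRowTest s ∨ IsAffineTest s) ∧ LabelRowAffine g P ∧ LabelRowAffine g Q
  | .bob s P Q => (IsLabelTest g s ∨ IsRowTest s ∨ IsAffineTest s) ∧ LabelRowAffine g P ∧ LabelRowAffine g Q

/-- [verbatim `P4g18.StrongCompositionLRA`] K2 = C1 restricted to LRA (OPEN). -/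
def StrongCompositionLRA : Prop :=
  ∃ c : ℕ, ∀ m n : ℕ, 1 ≤ n → ∀ f : (Fin m → Bool) → Bool, (∃ a b, f a ≠ f b) →
    ∃ g : (Fin n → Bool) → Bool, ∀ P : KWTree (Fin m × Fin n), LabelRowAffine g P → P.SolvesStrong f g →
      ∃ Q : KWTree (Fin m), Q.Solves f ∧ Q.depth + n ≤ P.depth + c * (Nat.log 2 (m * n) + 1)

/-! ### The mixed class LAM (new): node tests `φ(a) ⊕ ⨁_{p ∈ S} X_p` -/

/-- A MIXED (label-affine) node test: an arbitrary function of the own label vector XOR a parity of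
entries.  `S = ∅` is a label test, `φ` constant is an affine test; `φ(a) = a_i`, `S ⊆` row `i'` is the
mixed parity `a_i ⊕ u'(X_{i'})` that LRA synthesises (`jointBit_synthesis`). -/
def IsMixedTest (g : (Fin n → Bool) → Bool) (s : (Fin m × Fin n → Bool) → Bool) : Prop :=
  ∃ (φ : (Fin m → Bool) → Bool) (S : Finset (Fin m × Fin n)),
    ∀ X, s X = Bool.xor (φ (rowLabels g X)) (parityOn S X)

/-- **Class LAM**: every node test is mixed. -/
def LabelAffineMixed (g : (Fin n → Bool) → Bool) : KWTree (Fin m × Fin n) → Prop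
  | .leaf _ => True
  | .alice s P Q => IsMixedTest g s ∧ LabelAffineMixed g P ∧ LabelAffineMixed g Q
  | .bob s P Q => IsMixedTest g s ∧ LabelAffineMixed g P ∧ LabelAffineMixed g Q

/-- C1 restricted to LAM (OPEN; contains the twist-debt mechanism, memo §2). -/
def StrongCompositionLAM : Prop :=
  ∃ c : ℕ, ∀ m n : ℕ, 1 ≤ n → ∀ f : (Fin m → Bool) → Bool, (∃ a b, f a ≠ f b) →
    ∃ g : (Fin n → Bool) → Bool, ∀ P : KWTree (Fin m × Fin n), LabelAffineMixed g P → P.SolvesStrong f g →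
      ∃ Q : KWTree (Fin m), Q.Solves f ∧ Q.depth + n ≤ P.depth + c * (Nat.log 2 (m * n) + 1)

theorem IsLabelTest.isMixed {g : (Fin n → Bool) → Bool} {s : (Fin m × Fin n → Bool) → Bool}
    (h : IsLabelTest g s) : IsMixedTest g s := by
  obtain ⟨φ, hφ⟩ := h
  refine ⟨φ, ∅, fun X => ?_⟩
  rw [hφ]
  simp [parityOn]

theorem IsAffineTest.isMixed (g : (Fin n → Bool) → Bool) {s : (Fin m × Fin n → Bool) → Bool}
    (h : IsAffineTest s) : IsMixedTest g s := by
  obtain ⟨S, c, hS⟩ := h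
  exact ⟨fun _ => c, S, hS⟩

/-- L⁺ ⊆ LAM. -/
theorem LabelAffine.labelAffineMixed {g : (Fin n → Bool) → Bool} :
    ∀ {P : KWTree (Fin m × Fin n)}, LabelAffine g P → LabelAffineMixed g P
  | .leaf _, _ => trivial
  | .alice _ _ _, ⟨h, hP, hQ⟩ =>
      ⟨h.elim IsLabelTest.isMixed (IsAffineTest.isMixed g), hP.labelAffineMixed, hQ.labelAffineMixed⟩
  | .bob _ _ _, ⟨h, hP, hQ⟩ =>
      ⟨h.elim IsLabelTest.isMixed (IsAffineTest.isMixed g), hP.labelAffineMixed, hQ.labelAffineMixed⟩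

theorem lam_of_strongComposition :
    Theses.KrwChromaticSteering.StrongComposition → StrongCompositionLAM := by
  rintro ⟨c, h⟩
  refine ⟨c, fun m n hn f hf => ?_⟩
  obtain ⟨g, hg⟩ := h m n hn f hf
  exact ⟨g, fun P _ hP => hg P hP⟩

theorem labelAffine_of_lam : StrongCompositionLAM → StrongCompositionLabelAffine := by
  rintro ⟨c, h⟩
  refine ⟨c, fun m n hn f hf => ?_⟩
  obtain ⟨g, hg⟩ := h m n hn f hf
  exact ⟨g, fun P hL hP => hg P hL.labelAffineMixed hP⟩

/-- The synthesised test of `jointBit_synthesis` is a mixed test (with `φ(a) = a_i`, support in row `i'`),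
recorded as the statement that `X ↦ a_i ⊕ u'(X_{i'})` for a parity `u'` lies in LAM's test basis. -/
theorem jointBit_isMixed (g : (Fin n → Bool) → Bool) (i i' : Fin m) (S' : Finset (Fin n)) :
    IsMixedTest g (fun X : Fin m × Fin n → Bool =>
      Bool.xor (rowLabels g X i) (parityOn (S'.map ⟨fun j => (i', j), fun _ _ h => (Prod.mk.inj h).2⟩) X)) :=
  ⟨fun a => a i, _, fun _ => rfl⟩

/-- **Joint-bit synthesis.**  The 2-row affine bit `u(X_i) ⊕ u'(X_{i'})` and the single-row bit
`u(X_i) ⊕ g(X_i)` — both legal LRA tests — together determine the JOINT label–row parity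
`g(X_i) ⊕ u'(X_{i'})` (neither a label test, nor a row test, nor affine). -/
theorem jointBit_synthesis (g u u' : (Fin n → Bool) → Bool) (x x' : Fin n → Bool) :
    Bool.xor (Bool.xor (u x) (u' x')) (Bool.xor (u x) (g x)) = Bool.xor (g x) (u' x') := by
  cases u x <;> cases u' x' <;> cases g x <;> decide

/-- The same, stated on matrices and protocol tests: if Alice's answers to the tests
`s₁ X = u (row X i) ⊕ u' (row X i')` and `s₂ X = u (row X i) ⊕ g (row X i)` are `β₁, β₂`, then on every
consistent input the joint bit `rowLabels g X i ⊕ u' (row X i')` equals `β₁ ⊕ β₂`. -/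
theorem jointBit_of_answers (g u u' : (Fin n → Bool) → Bool) (i i' : Fin m)
    (X : Fin m × Fin n → Bool) (β₁ β₂ : Bool)
    (h₁ : Bool.xor (u (row X i)) (u' (row X i')) = β₁) (h₂ : Bool.xor (u (row X i)) (g (row X i)) = β₂) :
    Bool.xor (rowLabels g X i) (u' (row X i')) = Bool.xor β₁ β₂ := by
  rw [← h₁, ← h₂, jointBit_synthesis]
  rfl

/-- The row type a path assigns online: untouched, algebraic (met by an affine test), combinatorial
(met by a single-row test). -/
inductive RowType
  | fresh
  | algebraic
  | combinatorial
  deriving DecidableEq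

/-- The rows an affine support `S` touches. -/
def touchedRows (S : Finset (Fin m × Fin n)) : Finset (Fin m) := S.image Prod.fst

/-- Retyping below an affine node: touched rows become `algebraic`. -/
def retag (S : Finset (Fin m × Fin n)) (τ : Fin m → RowType) : Fin m → RowType :=
  fun i => if i ∈ touchedRows S then RowType.algebraic else τ i

theorem retag_ne_combinatorial (S : Finset (Fin m × Fin n)) {τ : Fin m → RowType}
    (hτ : ∀ i, τ i ≠ .combinatorial) (i : Fin m) : retag S τ i ≠ .combinatorial := by
  unfold retag
  split
  · exact fun h => RowType.noConfusion h
  · exact hτ i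

theorem update_ne_algebraic {τ : Fin m → RowType} (hτ : ∀ i, τ i ≠ .algebraic) (i i' : Fin m) :
    Function.update τ i RowType.combinatorial i' ≠ .algebraic := by
  rcases eq_or_ne i' i with rfl | hne
  · rw [Function.update_self]
    exact fun h => RowType.noConfusion h
  · rw [Function.update_of_ne hne]
    exact hτ i'

/-- One node of **the disciplined class LRAD** (relative to an online typing `τ`): the test is a label
test (typing unchanged), OR an affine test whose support avoids `combinatorial` rows (touched rows become
`algebraic` below it), OR a single-row test on a row that is not `algebraic` (it becomes `combinatorial`
below it).  `NodeOK g τ s τ'` says: test `s` is legal at typing `τ` and `τ'` is the typing below it. -/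
def NodeOK (g : (Fin n → Bool) → Bool) (τ : Fin m → RowType) (s : (Fin m × Fin n → Bool) → Bool)
    (τ' : Fin m → RowType) : Prop :=
  (IsLabelTest g s ∧ τ' = τ) ∨
  (∃ (S : Finset (Fin m × Fin n)) (c : Bool), (∀ X, s X = Bool.xor c (parityOn S X)) ∧
      (∀ i ∈ touchedRows S, τ i ≠ .combinatorial) ∧ τ' = retag S τ) ∨
  (∃ (i : Fin m) (ψ : (Fin n → Bool) → Bool), (∀ X, s X = ψ (row X i)) ∧ τ i ≠ .algebraic ∧
      τ' = Function.update τ i .combinatorial)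

/-- **Class LRAD**: along every root–leaf path no row carries both a single-row test and an affine test
(rows are typed online at first touch). -/
def LRADisciplinedOn (g : (Fin n → Bool) → Bool) : (Fin m → RowType) → KWTree (Fin m × Fin n) → Prop
  | _, .leaf _ => True
  | τ, .alice s P Q => ∃ τ', NodeOK g τ s τ' ∧ LRADisciplinedOn g τ' P ∧ LRADisciplinedOn g τ' Q
  | τ, .bob s P Q => ∃ τ', NodeOK g τ s τ' ∧ LRADisciplinedOn g τ' P ∧ LRADisciplinedOn g τ' Q

/-- Disciplined from the all-`fresh` typing. -/
def LRADisciplined (g : (Fin n → Bool) → Bool) (P : KWTree (Fin m × Fin n)) : Prop :=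
  LRADisciplinedOn g (fun _ => RowType.fresh) P

/-- **C1 restricted to the disciplined class** — the rung between {M3, L⁺} and K2 (`g` existential,
loss `O(log mn)`, verbatim C1 otherwise). -/
def StrongCompositionLRAD : Prop :=
  ∃ c : ℕ, ∀ m n : ℕ, 1 ≤ n → ∀ f : (Fin m → Bool) → Bool, (∃ a b, f a ≠ f b) →
    ∃ g : (Fin n → Bool) → Bool, ∀ P : KWTree (Fin m × Fin n), LRADisciplined g P → P.SolvesStrong f g →
      ∃ Q : KWTree (Fin m), Q.Solves f ∧ Q.depth + n ≤ P.depth + c * (Nat.log 2 (m * n) + 1)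

/-- C1 implies its LRAD restriction (a refutation of the rung refutes C1; a proof is a rung). -/
theorem lrad_of_strongComposition :
    Theses.KrwChromaticSteering.StrongComposition → StrongCompositionLRAD := by
  rintro ⟨c, h⟩
  refine ⟨c, fun m n hn f hf => ?_⟩
  obtain ⟨g, hg⟩ := h m n hn f hf
  exact ⟨g, fun P _ hP => hg P hP⟩

/-- A legal node test is an LRA test. -/
theorem NodeOK.lra {g : (Fin n → Bool) → Bool} {τ τ' : Fin m → RowType}
    {s : (Fin m × Fin n → Bool) → Bool} (h : NodeOK g τ s τ') :
    IsLabelTest g s ∨ IsRowTest s ∨ IsAffineTest s := by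
  rcases h with ⟨hs, -⟩ | ⟨S, c, hs, -, -⟩ | ⟨i, ψ, hs, -, -⟩
  · exact Or.inl hs
  · exact Or.inr (Or.inr ⟨S, c, hs⟩)
  · exact Or.inr (Or.inl ⟨i, ψ, hs⟩)

/-- A disciplined tree is an LRA tree (forget the typing). -/
theorem LRADisciplinedOn.labelRowAffine {g : (Fin n → Bool) → Bool} :
    ∀ (τ : Fin m → RowType) (P : KWTree (Fin m × Fin n)), LRADisciplinedOn g τ P → LabelRowAffine g P
  | _, .leaf _, _ => trivial
  | τ, .alice s P Q, h => by
    obtain ⟨τ', hs, hP, hQ⟩ := h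
    exact ⟨hs.lra, LRADisciplinedOn.labelRowAffine τ' P hP, LRADisciplinedOn.labelRowAffine τ' Q hQ⟩
  | τ, .bob s P Q, h => by
    obtain ⟨τ', hs, hP, hQ⟩ := h
    exact ⟨hs.lra, LRADisciplinedOn.labelRowAffine τ' P hP, LRADisciplinedOn.labelRowAffine τ' Q hQ⟩

/-- Hence K2 (`StrongCompositionLRA`) implies the disciplined rung. -/
theorem lrad_of_lra : StrongCompositionLRA → StrongCompositionLRAD := by
  rintro ⟨c, h⟩
  refine ⟨c, fun m n hn f hf => ?_⟩
  obtain ⟨g, hg⟩ := h m n hn f hf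
  exact ⟨g, fun P hD hP => hg P (LRADisciplinedOn.labelRowAffine _ P hD) hP⟩

/-- An L⁺ tree (label ∨ affine tests) is disciplined for any typing without `combinatorial` rows. -/
theorem LabelAffine.lraDisciplinedOn {g : (Fin n → Bool) → Bool} :
    ∀ (τ : Fin m → RowType) (P : KWTree (Fin m × Fin n)), (∀ i, τ i ≠ .combinatorial) →
      LabelAffine g P → LRADisciplinedOn g τ P
  | _, .leaf _, _, _ => trivial
  | τ, .alice s P Q, hτ, h => by
    obtain ⟨hs, hP, hQ⟩ := h
    rcases hs with hs | ⟨S, c, hs⟩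
    · exact ⟨τ, Or.inl ⟨hs, rfl⟩, LabelAffine.lraDisciplinedOn τ P hτ hP,
        LabelAffine.lraDisciplinedOn τ Q hτ hQ⟩
    · exact ⟨retag S τ, Or.inr (Or.inl ⟨S, c, hs, fun i _ => hτ i, rfl⟩),
        LabelAffine.lraDisciplinedOn _ P (retag_ne_combinatorial S hτ) hP,
        LabelAffine.lraDisciplinedOn _ Q (retag_ne_combinatorial S hτ) hQ⟩
  | τ, .bob s P Q, hτ, h => by
    obtain ⟨hs, hP, hQ⟩ := h
    rcases hs with hs | ⟨S, c, hs⟩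
    · exact ⟨τ, Or.inl ⟨hs, rfl⟩, LabelAffine.lraDisciplinedOn τ P hτ hP,
        LabelAffine.lraDisciplinedOn τ Q hτ hQ⟩
    · exact ⟨retag S τ, Or.inr (Or.inl ⟨S, c, hs, fun i _ => hτ i, rfl⟩),
        LabelAffine.lraDisciplinedOn _ P (retag_ne_combinatorial S hτ) hP,
        LabelAffine.lraDisciplinedOn _ Q (retag_ne_combinatorial S hτ) hQ⟩

/-- So the disciplined rung implies g18's proved rung `C1|L⁺` (LRAD sits between L⁺ and LRA). -/
theorem labelAffine_of_lrad : StrongCompositionLRAD → StrongCompositionLabelAffine := by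
  rintro ⟨c, h⟩
  refine ⟨c, fun m n hn f hf => ?_⟩
  obtain ⟨g, hg⟩ := h m n hn f hf
  exact ⟨g, fun P hL hP =>
    hg P (LabelAffine.lraDisciplinedOn _ P (fun _ h => RowType.noConfusion h) hL) hP⟩

/-- [verbatim `LabelPublic.LabelPublic`, p5 g17] M3's class: every node test is a label test or a
public single-row test (C1 on this class is PROVED: `LabelPublic.strongComposition_labelPublic`). -/
def LabelPublic (g : (Fin n → Bool) → Bool) : KWTree (Fin m × Fin n) → Prop
  | .leaf _ => True
  | .alice s P Q =>
      ((∃ φ : (Fin m → Bool) → Bool, ∀ X, s X = φ (rowLabels g X)) ∨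
        (∃ (i : Fin m) (ψ : (Fin n → Bool) → Bool), ∀ X, s X = ψ (row X i))) ∧
      LabelPublic g P ∧ LabelPublic g Q
  | .bob s P Q =>
      ((∃ φ : (Fin m → Bool) → Bool, ∀ Y, s Y = φ (rowLabels g Y)) ∨
        (∃ (i : Fin m) (ψ : (Fin n → Bool) → Bool), ∀ Y, s Y = ψ (row Y i))) ∧
      LabelPublic g P ∧ LabelPublic g Q

/-- A label-public separable tree (M3's class: label ∨ public single-row tests) is disciplined for any
typing without `algebraic` rows. -/
theorem LabelPublic.lraDisciplinedOn {g : (Fin n → Bool) → Bool} :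
    ∀ (τ : Fin m → RowType) (P : KWTree (Fin m × Fin n)), (∀ i, τ i ≠ .algebraic) →
      LabelPublic g P → LRADisciplinedOn g τ P
  | _, .leaf _, _, _ => trivial
  | τ, .alice s P Q, hτ, h => by
    have h' : ((∃ φ : (Fin m → Bool) → Bool, ∀ X, s X = φ (rowLabels g X)) ∨
        (∃ (i : Fin m) (ψ : (Fin n → Bool) → Bool), ∀ X, s X = ψ (row X i))) ∧
      LabelPublic g P ∧ LabelPublic g Q := h
    obtain ⟨hs, hP, hQ⟩ := h'
    rcases hs with ⟨φ, hφ⟩ | ⟨i, ψ, hψ⟩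
    · exact ⟨τ, Or.inl ⟨⟨φ, hφ⟩, rfl⟩, LabelPublic.lraDisciplinedOn τ P hτ hP,
        LabelPublic.lraDisciplinedOn τ Q hτ hQ⟩
    · exact ⟨_, Or.inr (Or.inr ⟨i, ψ, hψ, hτ i, rfl⟩),
        LabelPublic.lraDisciplinedOn _ P (update_ne_algebraic hτ i) hP,
        LabelPublic.lraDisciplinedOn _ Q (update_ne_algebraic hτ i) hQ⟩
  | τ, .bob s P Q, hτ, h => by
    have h' : ((∃ φ : (Fin m → Bool) → Bool, ∀ Y, s Y = φ (rowLabels g Y)) ∨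
        (∃ (i : Fin m) (ψ : (Fin n → Bool) → Bool), ∀ Y, s Y = ψ (row Y i))) ∧
      LabelPublic g P ∧ LabelPublic g Q := h
    obtain ⟨hs, hP, hQ⟩ := h'
    rcases hs with ⟨φ, hφ⟩ | ⟨i, ψ, hψ⟩
    · exact ⟨τ, Or.inl ⟨⟨φ, hφ⟩, rfl⟩, LabelPublic.lraDisciplinedOn τ P hτ hP,
        LabelPublic.lraDisciplinedOn τ Q hτ hQ⟩
    · exact ⟨_, Or.inr (Or.inr ⟨i, ψ, hψ, hτ i, rfl⟩),
        LabelPublic.lraDisciplinedOn _ P (update_ne_algebraic hτ i) hP,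
        LabelPublic.lraDisciplinedOn _ Q (update_ne_algebraic hτ i) hQ⟩

/-- So the disciplined rung implies C1 on M3's class as well (p5's `strongComposition_labelPublic` proves
that class outright; this is the consistency check that LRAD contains it). -/
theorem labelPublic_of_lrad (h : StrongCompositionLRAD) :
    ∃ c : ℕ, ∀ m n : ℕ, 1 ≤ n → ∀ f : (Fin m → Bool) → Bool, (∃ a b, f a ≠ f b) →
      ∃ g : (Fin n → Bool) → Bool, ∀ P : KWTree (Fin m × Fin n), LabelPublic g P →
        P.SolvesStrong f g →
        ∃ Q : KWTree (Fin m), Q.Solves f ∧ Q.depth + n ≤ P.depth + c * (Nat.log 2 (m * n) + 1) := by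
  obtain ⟨c, h⟩ := h
  refine ⟨c, fun m n hn f hf => ?_⟩
  obtain ⟨g, hg⟩ := h m n hn f hf
  exact ⟨g, fun P hL hP =>
    hg P (LabelPublic.lraDisciplinedOn _ P (fun _ h => RowType.noConfusion h) hL) hP⟩

end Discipline


/-! ## §5 PerRowBudget — label-universality with a budget PER ROW (support statement S3, typed)

L⁺ (`P4g18.depth_lower_bound`) spends ONE global budget `q − 1` of parity equations for the whole
`m × n` matrix (`MatrixLU g m q`: at most `q` equations in total).  The merged adversaries of the memo
(§2, §5) charge an affine equation to the rows it touches and use a MIN over rows, which needs the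
sharper universality below: a satisfiable system in which every ROW is touched by at most `q` equations
has a solution with every prescribed label vector.  Why true (memo §5.3, S3): let `V_i` be the span of
the equations of `span(E)` supported on rows `≤ i`; `dim V_i − dim V_{i−1} ≤ #{e ∈ E touching row i}`
because `V_i / V_{i−1}` injects into the span of the row-`i` parts of the equations touching row `i`;
choose the rows in order `1, …, m`, row `i` subject to `dim V_i − dim V_{i−1} ≤ q ≤ n − r − 1`
independent affine conditions, inside which an `r`-generic `g` takes the wanted label. -/

section PerRowBudget

variable {m n : ℕ}

/-- [verbatim `P4g18.AffSys`] A system of parity equations on `m × n` matrices. -/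
abbrev AffSys (m n : ℕ) := List (Finset (Fin m × Fin n) × Bool)

/-- [verbatim `P4g18.Sat`] `X` satisfies every equation of `E`. -/
def Sat (E : AffSys m n) (X : Fin m × Fin n → Bool) : Prop := ∀ e ∈ E, parityOn e.1 X = e.2

/-- [verbatim `P4g18.MatrixLU`] Label-universality up to `q` equations IN TOTAL. -/
def MatrixLU (g : (Fin n → Bool) → Bool) (m q : ℕ) : Prop :=
  ∀ E : AffSys m n, E.length ≤ q → (∃ X, Sat E X) → ∀ v : Fin m → Bool, ∃ X, Sat E X ∧ rowLabels g X = v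

/-- [verbatim `P4g18.rowParity`] Parity of `x` on a support `S ⊆ [n]` (one row). -/
def rowParity (S : Finset (Fin n)) (x : Fin n → Bool) : Bool := Nat.bodd (S.filter fun j => x j = true).card

/-- [verbatim `P4g18.AffGeneric`] `r`-affine-genericity of `g` by equations. -/
def AffGeneric (g : (Fin n → Bool) → Bool) (r : ℕ) : Prop :=
  ∀ E : List (Finset (Fin n) × Bool), E.length + r + 1 ≤ n →
    (∃ x, ∀ e ∈ E, rowParity e.1 x = e.2) → ∀ β : Bool, ∃ x, (∀ e ∈ E, rowParity e.1 x = e.2) ∧ g x = β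

/-- The rows an equation support touches. -/
def eqRows (S : Finset (Fin m × Fin n)) : Finset (Fin m) := S.image Prod.fst

/-- ROW LOAD: the number of equations of `E` whose support meets row `i`. -/
def rowLoad (E : AffSys m n) (i : Fin m) : ℕ := (E.filter fun e => i ∈ eqRows e.1).length

theorem rowLoad_le_length (E : AffSys m n) (i : Fin m) : rowLoad E i ≤ E.length :=
  List.length_filter_le _ _

/-- **Label-universality with a per-row budget** `q`: every satisfiable system touching each row at most
`q` times has, for every label vector, a solution carrying those labels. -/
def PerRowLU (g : (Fin n → Bool) → Bool) (m q : ℕ) : Prop :=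
  ∀ E : AffSys m n, (∀ i, rowLoad E i ≤ q) → (∃ X, Sat E X) →
    ∀ v : Fin m → Bool, ∃ X, Sat E X ∧ rowLabels g X = v

/-- The per-row budget refines the global one. -/
theorem matrixLU_of_perRowLU {g : (Fin n → Bool) → Bool} {q : ℕ} (h : PerRowLU g m q) :
    MatrixLU g m q := fun E hE hsat v =>
  h E (fun i => (rowLoad_le_length E i).trans hE) hsat v

/-- **S3 (support statement, unproved here)**: an `r`-generic non-constant `g` is label-universal with
PER-ROW budget `n − r − 1`, for every number of rows.  Proof route in the section docstring (filtration
`V_i`, `dim V_i − dim V_{i−1} ≤ rowLoad E i`, rows chosen in order).  It strictly strengthens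
`P4g18.MatrixLUOfGeneric` (`matrixLU_of_perRowLU`). -/
def PerRowLUOfGeneric : Prop :=
  ∀ (m n r : ℕ) (g : (Fin n → Bool) → Bool), (∃ u v, g u = true ∧ g v = false) →
    AffGeneric g r → PerRowLU g m (n - r - 1)

/-! ### S3 PROVED: `perRowLUOfGeneric_holds` (row surgery, ported from g18's `matrixLUOfGeneric_holds`
with the one change that genericity is applied to the equations TOUCHING the row being re-chosen —
`rowLoad E i` of them — the others being invariant under `setRow`) -/

/-- [verbatim `P4g18.setRow`] Replace row `i` of `X` by `y`. -/
def setRow (X : Fin m × Fin n → Bool) (i : Fin m) (y : Fin n → Bool) : Fin m × Fin n → Bool :=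
  fun p => if p.1 = i then y p.2 else X p

@[simp] theorem row_setRow_same (X : Fin m × Fin n → Bool) (i : Fin m) (y : Fin n → Bool) :
    row (setRow X i y) i = y := by
  funext j; simp [row, setRow]

theorem row_setRow_of_ne (X : Fin m × Fin n → Bool) {i i' : Fin m} (y : Fin n → Bool) (h : i' ≠ i) :
    row (setRow X i y) i' = row X i' := by
  funext j; simp [row, setRow, h]

/-- [verbatim `P4g18.rowSupp`] The row-`i` part of a support, as a subset of `[n]`. -/
def rowSupp (S : Finset (Fin m × Fin n)) (i : Fin m) : Finset (Fin n) :=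
  (S.filter fun p => p.1 = i).image Prod.snd

/-- [verbatim `P4g18.offRow`] The off-row-`i` part of a support. -/
def offRow (S : Finset (Fin m × Fin n)) (i : Fin m) : Finset (Fin m × Fin n) :=
  S.filter fun p => p.1 ≠ i

/-- [verbatim `P4g18.parityOn_setRow`] -/
theorem parityOn_setRow (S : Finset (Fin m × Fin n)) (X : Fin m × Fin n → Bool) (i : Fin m)
    (y : Fin n → Bool) :
    parityOn S (setRow X i y) = Bool.xor (rowParity (rowSupp S i) y) (parityOn (offRow S i) X) := by
  unfold parityOn rowParity
  have hsplit : S.filter (fun p => setRow X i y p = true)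
      = (S.filter fun p => p.1 = i).filter (fun p => y p.2 = true)
        ∪ (offRow S i).filter (fun p => X p = true) := by
    ext p
    rcases p with ⟨i', j⟩
    simp only [Finset.mem_filter, Finset.mem_union, offRow]
    by_cases h : i' = i
    · subst h; simp [setRow]
    · simp [setRow, h]
  have hdisj : Disjoint ((S.filter fun p => p.1 = i).filter (fun p => y p.2 = true))
      ((offRow S i).filter (fun p => X p = true)) := by
    rw [Finset.disjoint_left]
    intro p hp hq
    simp only [Finset.mem_filter, offRow] at hp hq
    exact hq.1.2 hp.1.2
  have hcard : ((S.filter fun p => p.1 = i).filter (fun p => y p.2 = true)).card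
      = ((rowSupp S i).filter fun j => y j = true).card := by
    unfold rowSupp
    rw [Finset.filter_image, Finset.card_image_of_injOn]
    rintro ⟨i₁, j₁⟩ hp ⟨i₂, j₂⟩ hq h
    simp only [Finset.coe_filter, Set.mem_setOf_eq, Finset.mem_filter] at hp hq
    simp only at h
    subst h
    rcases hp with ⟨⟨_, rfl⟩, _⟩
    rcases hq with ⟨⟨_, rfl⟩, _⟩
    rfl
  rw [hsplit, Finset.card_union_of_disjoint hdisj, Nat.bodd_add, hcard]

/-- [verbatim `P4g18.restrictRow`] The system `E` restricted to row `i`, the other rows frozen at `X`. -/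
def restrictRow (E : AffSys m n) (i : Fin m) (X : Fin m × Fin n → Bool) :
    List (Finset (Fin n) × Bool) :=
  E.map fun e => (rowSupp e.1 i, Bool.xor e.2 (parityOn (offRow e.1 i) X))

/-- An equation not touching row `i` has empty row-`i` support … -/
theorem rowSupp_eq_empty {S : Finset (Fin m × Fin n)} {i : Fin m} (h : i ∉ eqRows S) :
    rowSupp S i = ∅ := by
  unfold rowSupp
  rw [Finset.image_eq_empty, Finset.filter_eq_empty_iff]
  intro p hp hpi
  exact h (Finset.mem_image.2 ⟨p, hp, hpi⟩)

/-- … and is its own off-row part. -/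
theorem offRow_eq_self {S : Finset (Fin m × Fin n)} {i : Fin m} (h : i ∉ eqRows S) :
    offRow S i = S := by
  unfold offRow
  rw [Finset.filter_eq_self]
  intro p hp hpi
  exact h (Finset.mem_image.2 ⟨p, hp, hpi⟩)

theorem rowParity_empty (y : Fin n → Bool) : rowParity (∅ : Finset (Fin n)) y = false := by
  simp [rowParity]

/-- The equations of `E` touching row `i`. -/
def touching (E : AffSys m n) (i : Fin m) : AffSys m n := E.filter fun e => i ∈ eqRows e.1

theorem length_touching (E : AffSys m n) (i : Fin m) : (touching E i).length = rowLoad E i := rfl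

/-- Row surgery with the TOUCHING equations only: if `X ⊨ E` and `y` satisfies the row-`i` restriction
of the equations touching row `i`, then `setRow X i y ⊨ E`. -/
theorem sat_setRow_of_touching {E : AffSys m n} {X : Fin m × Fin n → Bool} (hX : Sat E X) (i : Fin m)
    {y : Fin n → Bool} (hy : ∀ e ∈ restrictRow (touching E i) i X, rowParity e.1 y = e.2) :
    Sat E (setRow X i y) := by
  intro e he
  rw [parityOn_setRow]
  by_cases ht : i ∈ eqRows e.1
  · have hmem : (rowSupp e.1 i, Bool.xor e.2 (parityOn (offRow e.1 i) X))
        ∈ restrictRow (touching E i) i X := by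
      simp only [restrictRow, touching, List.mem_map, List.mem_filter, decide_eq_true_eq]
      exact ⟨e, ⟨he, ht⟩, rfl⟩
    have h1 := hy _ hmem
    simp only at h1
    rw [h1]
    cases e.2 <;> cases parityOn (offRow e.1 i) X <;> rfl
  · rw [rowSupp_eq_empty ht, offRow_eq_self ht, rowParity_empty, hX e he]
    cases e.2 <;> rfl

/-- The current row satisfies its own restriction. -/
theorem restrictRow_row_self {E : AffSys m n} {X : Fin m × Fin n → Bool} (hX : Sat E X) (i : Fin m) :
    ∀ e ∈ restrictRow (touching E i) i X, rowParity e.1 (row X i) = e.2 := by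
  intro e' he'
  simp only [restrictRow, List.mem_map] at he'
  obtain ⟨e, he, rfl⟩ := he'
  have heE : e ∈ E := (List.mem_filter.1 he).1
  have h1 := hX e heE
  have h2 : parityOn e.1 (setRow X i (row X i)) = e.2 := by
    have : setRow X i (row X i) = X := by
      funext p
      rcases p with ⟨i', j⟩
      by_cases h : i' = i
      · subst h; simp [setRow, row]
      · simp [setRow, h]
    rw [this]; exact h1
  rw [parityOn_setRow] at h2
  simp only
  rw [← h2]
  cases rowParity (rowSupp e.1 i) (row X i) <;> cases parityOn (offRow e.1 i) X <;> rfl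

/-- **S3 holds**: per-row label-universality of an `r`-generic non-constant `g` with budget `n − r − 1`
equations PER ROW (for every number of rows). -/
theorem perRowLUOfGeneric_holds : PerRowLUOfGeneric := by
  intro m n r g hg hgen E hload hsat v
  obtain ⟨u, w, hu, hw⟩ := hg
  have key : ∀ k, k ≤ m → ∃ X, Sat E X ∧ ∀ i : Fin m, i.val < k → g (row X i) = v i := by
    intro k
    induction k with
    | zero =>
      intro _
      obtain ⟨X, hX⟩ := hsat
      exact ⟨X, hX, fun i hi => absurd hi (Nat.not_lt_zero _)⟩
    | succ k ih =>
      intro hk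
      obtain ⟨X, hX, hlab⟩ := ih (by omega)
      obtain ⟨i, hi⟩ : ∃ i : Fin m, i.val = k := ⟨⟨k, by omega⟩, rfl⟩
      -- a new row `y` with label `v i` satisfying the touching restriction
      have hy : ∃ y : Fin n → Bool,
          (∀ e ∈ restrictRow (touching E i) i X, rowParity e.1 y = e.2) ∧ g y = v i := by
        by_cases h0 : rowLoad E i = 0
        · -- no equation touches row `i`: any row will do
          have hnil : restrictRow (touching E i) i X = [] := by
            have : touching E i = [] := List.eq_nil_of_length_eq_zero (by rw [length_touching]; exact h0)
            simp [restrictRow, this]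
          cases hvi : v i
          · exact ⟨w, by simp [hnil], hw⟩
          · exact ⟨u, by simp [hnil], hu⟩
        · have hEi : (restrictRow (touching E i) i X).length + r + 1 ≤ n := by
            simp only [restrictRow, List.length_map, length_touching]
            have := hload i
            omega
          exact hgen _ hEi ⟨row X i, restrictRow_row_self hX i⟩ (v i)
      obtain ⟨y, hy, hgy⟩ := hy
      refine ⟨setRow X i y, sat_setRow_of_touching hX i hy, fun i' hi' => ?_⟩
      by_cases h : i' = i
      · subst h; simpa using hgy
      · rw [row_setRow_of_ne _ _ h]
        have : i'.val ≠ k := fun hh => h (Fin.ext (hh.trans hi.symm))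
        exact hlab i' (by omega)
  obtain ⟨X, hX, hlab⟩ := key m le_rfl
  exact ⟨X, hX, funext fun i => by simpa using hlab i i.isLt⟩

/-! ### S2 PROVED: fibred realisability (the `E`-fibred form of M3's `exists_X` / `exists_X_row`)
In the LRAD state rows are TYPED: an affine system `E` (per-row loads `≤ q`) touches only rows whose row-set
is unconstrained (`algebraic`), the other rows carry M3's arbitrary row-sets `S i` and no equation.  Given
per-row label-universality, every coordinatewise-realisable label vector is realised by a matrix satisfying
`E`, with all rows in their sets and one untouched row prescribed. -/

theorem parityOn_congr {S : Finset (Fin m × Fin n)} {X X' : Fin m × Fin n → Bool}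
    (h : ∀ p ∈ S, X p = X' p) : parityOn S X = parityOn S X' := by
  unfold parityOn
  rw [Finset.filter_congr (fun p hp => by rw [h p hp])]

theorem one_le_rowLoad_of_mem {E : AffSys m n} {e : Finset (Fin m × Fin n) × Bool} (he : e ∈ E)
    {i : Fin m} (hi : i ∈ eqRows e.1) : 1 ≤ rowLoad E i := by
  unfold rowLoad
  exact List.length_pos_iff_exists_mem.2 ⟨e, List.mem_filter.2 ⟨he, by simpa using hi⟩⟩

/-- **S2 (fibred realisability).** -/
theorem exists_X_fibred {g : (Fin n → Bool) → Bool} {q : ℕ} (hLU : PerRowLU g m q) {E : AffSys m n}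
    (hload : ∀ i, rowLoad E i ≤ q) (hsat : ∃ X, Sat E X) (S : Fin m → Set (Fin n → Bool))
    (htyped : ∀ i, rowLoad E i = 0 ∨ S i = Set.univ) {a : Fin m → Bool}
    (ha : ∀ i, ∃ x ∈ S i, g x = a i) {i₀ : Fin m} (hi₀ : rowLoad E i₀ = 0) {x : Fin n → Bool}
    (hx : x ∈ S i₀) (hgx : g x = a i₀) :
    ∃ X, Sat E X ∧ rowLabels g X = a ∧ (∀ i, row X i ∈ S i) ∧ row X i₀ = x := by
  classical
  obtain ⟨X₀, hX₀, hlab₀⟩ := hLU E hload hsat a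
  choose y hyS hyg using ha
  let y' : Fin m → Fin n → Bool := fun i => if i = i₀ then x else y i
  have hy'S : ∀ i, y' i ∈ S i := by
    intro i
    by_cases h : i = i₀
    · subst h; simpa [y'] using hx
    · simpa [y', h] using hyS i
  have hy'g : ∀ i, g (y' i) = a i := by
    intro i
    by_cases h : i = i₀
    · subst h; simpa [y'] using hgx
    · simpa [y', h] using hyg i
  let X : Fin m × Fin n → Bool := fun p => if rowLoad E p.1 = 0 then y' p.1 p.2 else X₀ p
  have hrow0 : ∀ i, rowLoad E i = 0 → row X i = y' i := fun i h => funext fun j => by simp [X, h]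
  have hrow1 : ∀ i, rowLoad E i ≠ 0 → row X i = row X₀ i := fun i h => funext fun j => by simp [X, h]
  refine ⟨X, ?_, ?_, ?_, ?_⟩
  · intro e he
    rw [← hX₀ e he]
    apply parityOn_congr
    intro p hp
    have h1 : 1 ≤ rowLoad E p.1 := one_le_rowLoad_of_mem he (Finset.mem_image.2 ⟨p, hp, rfl⟩)
    have h1' : rowLoad E p.1 ≠ 0 := by omega
    simp [X, h1']
  · funext i
    rw [rowLabels_apply]
    by_cases h : rowLoad E i = 0
    · rw [hrow0 i h, hy'g]
    · rw [hrow1 i h, ← rowLabels_apply g X₀ i, hlab₀]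
  · intro i
    rcases htyped i with h | h
    · rw [hrow0 i h]; exact hy'S i
    · rw [h]; exact Set.mem_univ _
  · rw [hrow0 i₀ hi₀]; simp [y']

/-- S2 without a prescribed row (M3's `exists_X`, fibred); needs one untouched row only to instantiate the
prescribed-row version — stated here directly. -/
theorem exists_X_fibred' {g : (Fin n → Bool) → Bool} {q : ℕ} (hLU : PerRowLU g m q) {E : AffSys m n}
    (hload : ∀ i, rowLoad E i ≤ q) (hsat : ∃ X, Sat E X) (S : Fin m → Set (Fin n → Bool))
    (htyped : ∀ i, rowLoad E i = 0 ∨ S i = Set.univ) {a : Fin m → Bool}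
    (ha : ∀ i, ∃ x ∈ S i, g x = a i) :
    ∃ X, Sat E X ∧ rowLabels g X = a ∧ ∀ i, row X i ∈ S i := by
  classical
  obtain ⟨X₀, hX₀, hlab₀⟩ := hLU E hload hsat a
  choose y hyS hyg using ha
  let X : Fin m × Fin n → Bool := fun p => if rowLoad E p.1 = 0 then y p.1 p.2 else X₀ p
  have hrow0 : ∀ i, rowLoad E i = 0 → row X i = y i := fun i h => funext fun j => by simp [X, h]
  have hrow1 : ∀ i, rowLoad E i ≠ 0 → row X i = row X₀ i := fun i h => funext fun j => by simp [X, h]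
  refine ⟨X, ?_, ?_, ?_⟩
  · intro e he
    rw [← hX₀ e he]
    apply parityOn_congr
    intro p hp
    have h1 : 1 ≤ rowLoad E p.1 := one_le_rowLoad_of_mem he (Finset.mem_image.2 ⟨p, hp, rfl⟩)
    have h1' : rowLoad E p.1 ≠ 0 := by omega
    simp [X, h1']
  · funext i
    rw [rowLabels_apply]
    by_cases h : rowLoad E i = 0
    · rw [hrow0 i h, hyg]
    · rw [hrow1 i h, ← rowLabels_apply g X₀ i, hlab₀]
  · intro i
    rcases htyped i with h | h
    · rw [hrow0 i h]; exact hyS i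
    · rw [h]; exact Set.mem_univ _

end PerRowBudget

/-! ## §6 S0 PROVED: one inner function that is BOTH Karchmer–Wigderson-depth-hard AND affine-generic

The LRAD recipe (memo §5) needs a single `g` carrying both hardness notions: KW-depth `≥ n − O(log n)`
(for the combinatorial rows, as in M3) and `AffGeneric g (2 (log₂ n + 1))` (for the algebraic rows, as in
L⁺).  Both existence proofs in the tree are counts against `2^{2^n}`; here they are made QUANTITATIVE and
added: functions of `B₂`-circuit size `≤ S` (`S + 2 = 2^{n − log₂ n − 4}`) number `≤ #Code(n,S) <
2^{2^{n−1}}` (the tree's Riordan–Shannon count, `CircuitCount.card_code_le`, one exponent sharper than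
`card_code_lt_two_pow_two_pow` states it), the affine-degenerate ones number `≤ 2^{2^n − 1}` (g18's count,
one bit sharper than stated there), and `2^{2^{n−1}} + 2^{2^n−1} ≤ 2^{2^n}`.  A function outside both sets
is non-constant, affine-generic, and every protocol for its KW game has depth `≥ n − log₂ n − 5`
(`KWTree.circuitSizeOver_B2_lt_two_pow_of_solves`).  Counting helpers `rowParity_insert … card_const_on_le`
are [verbatim P4g18 §6]. -/
section JointExistence

open Literature.Computability.MetaComplexity

variable {n : ℕ}

theorem rowParity_insert {S : Finset (Fin n)} {j : Fin n} (h : j ∉ S) (x : Fin n → Bool) :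
    rowParity (insert j S) x = Bool.xor (x j) (rowParity S x) := by
  unfold rowParity
  rw [Finset.filter_insert]
  by_cases hx : x j = true
  · rw [if_pos hx, Finset.card_insert_of_notMem (by simp [Finset.mem_filter, h]), Nat.bodd_add, hx]
    cases Nat.bodd (S.filter fun j => x j = true).card <;> rfl
  · rw [if_neg hx]
    simp only [Bool.not_eq_true] at hx
    rw [hx]
    cases Nat.bodd (S.filter fun j => x j = true).card <;> rfl

/-- Pointwise xor of two vectors. -/
def bxorVec (x y : Fin n → Bool) : Fin n → Bool := fun j => Bool.xor (x j) (y j)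

theorem rowParity_bxorVec (S : Finset (Fin n)) (x y : Fin n → Bool) :
    rowParity S (bxorVec x y) = Bool.xor (rowParity S x) (rowParity S y) := by
  induction S using Finset.induction_on with
  | empty => simp [rowParity]
  | insert j S hj ih =>
    rw [rowParity_insert hj, rowParity_insert hj, rowParity_insert hj, ih]
    simp only [bxorVec]
    cases x j <;> cases y j <;> cases rowParity S x <;> cases rowParity S y <;> rfl

/-- A satisfiable system of `k` parity equations on `{0,1}^n` has at least `2^{n-k}` solutions. -/
theorem two_pow_le_card_sol (E : List (Finset (Fin n) × Bool))
    (hsat : ∃ x, ∀ e ∈ E, rowParity e.1 x = e.2) :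
    2 ^ (n - E.length) ≤
      (Finset.univ.filter fun x : Fin n → Bool => ∀ e ∈ E, rowParity e.1 x = e.2).card := by
  induction E with
  | nil => simp
  | cons e E ih =>
    obtain ⟨x₀, hx₀⟩ := hsat
    have hx₀E : ∀ e' ∈ E, rowParity e'.1 x₀ = e'.2 := fun e' he' => hx₀ e' (List.mem_cons_of_mem _ he')
    have hx₀e : rowParity e.1 x₀ = e.2 := hx₀ e List.mem_cons_self
    have ih' := ih ⟨x₀, hx₀E⟩
    set T := Finset.univ.filter (fun x : Fin n → Bool => ∀ e' ∈ E, rowParity e'.1 x = e'.2) with hT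
    have hT1eq : (Finset.univ.filter fun x : Fin n → Bool => ∀ e' ∈ e :: E, rowParity e'.1 x = e'.2)
        = T.filter fun x => rowParity e.1 x = e.2 := by
      ext x
      simp only [Finset.mem_filter, Finset.mem_univ, true_and, List.forall_mem_cons, hT]
      exact and_comm
    rw [hT1eq]
    have hsplit := Finset.card_filter_add_card_filter_not
      (s := T) (fun x => rowParity e.1 x = e.2)
    have hle : (T.filter fun x => ¬ rowParity e.1 x = e.2).card
        ≤ (T.filter fun x => rowParity e.1 x = e.2).card := by
      by_cases h0 : (T.filter fun x => ¬ rowParity e.1 x = e.2) = ∅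
      · rw [h0]; simp
      · obtain ⟨x₁, hx₁⟩ := Finset.nonempty_iff_ne_empty.mpr h0
        simp only [Finset.mem_filter, hT, Finset.mem_univ, true_and] at hx₁
        apply Finset.card_le_card_of_injOn (fun x => bxorVec (bxorVec x x₀) x₁)
        · intro x hx
          simp only [Finset.coe_filter, Finset.mem_filter, Finset.mem_univ, true_and, hT,
            Set.mem_setOf_eq] at hx ⊢
          refine ⟨fun e' he' => ?_, ?_⟩
          · rw [rowParity_bxorVec, rowParity_bxorVec, hx.1 e' he', hx₀E e' he', hx₁.1 e' he']
            cases e'.2 <;> rfl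
          · rw [rowParity_bxorVec, rowParity_bxorVec, hx₀e]
            have h1 := hx.2
            have h2 := hx₁.2
            revert h1 h2
            cases rowParity e.1 x <;> cases rowParity e.1 x₁ <;> cases e.2 <;> simp
        · intro x _ x' _ h
          funext j
          have := congr_fun h j
          simp only [bxorVec] at this
          revert this
          cases x j <;> cases x' j <;> cases x₀ j <;> cases x₁ j <;> simp
    have h1 : 1 ≤ (T.filter fun x => rowParity e.1 x = e.2).card := by
      apply Finset.card_pos.mpr
      refine ⟨x₀, ?_⟩
      rw [Finset.mem_filter, hT]
      exact ⟨by simp only [Finset.mem_filter, Finset.mem_univ, true_and]; exact hx₀E, hx₀e⟩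
    rcases Nat.eq_zero_or_pos (n - E.length) with hz | hpos
    · have : n - (e :: E).length = 0 := by simp only [List.length_cons]; omega
      rw [this]; simpa using h1
    · have heq : n - E.length = (n - (e :: E).length) + 1 := by simp only [List.length_cons]; omega
      rw [heq, pow_succ] at ih'
      omega

/-- Boolean functions on `{0,1}^n` that are constant `= b` on `T` number at most `2^{2^n − |T|}`. -/
theorem card_const_on_le (T : Finset (Fin n → Bool)) (b : Bool) :
    (Finset.univ.filter fun g : (Fin n → Bool) → Bool => ∀ x ∈ T, g x = b).card
      ≤ 2 ^ (2 ^ n - T.card) := by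
  have hc : Fintype.card ({x : Fin n → Bool // x ∉ T} → Bool) = 2 ^ (2 ^ n - T.card) := by
    rw [Fintype.card_fun, Fintype.card_bool, Fintype.card_subtype_compl, Fintype.card_coe]
    simp [Fintype.card_bool, Fintype.card_fin]
  rw [← hc, ← Finset.card_univ]
  apply Finset.card_le_card_of_injOn (fun g => fun x : {x : Fin n → Bool // x ∉ T} => g x.1)
  · intro g _; simp
  · intro g hg g' hg' h
    simp only [Finset.coe_filter, Finset.mem_univ, true_and, Set.mem_setOf_eq] at hg hg'
    funext x
    by_cases hx : x ∈ T
    · rw [hg x hx, hg' x hx]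
    · exact congr_fun h ⟨x, hx⟩

/-- The affine-degenerate functions are at most HALF of all functions (g18's STUB-2 count, sharpened by
one bit): outside a set of `≤ 2^{2^n − 1}` functions every `g` is `2 (log₂ n + 1)`-generic. -/
theorem exists_affBad (hrn : 2 * (Nat.log 2 n + 1) + 1 ≤ n) :
    ∃ Bad : Finset ((Fin n → Bool) → Bool), Bad.card ≤ 2 ^ (2 ^ n - 1) ∧
      ∀ g, g ∉ Bad → AffGeneric g (2 * (Nat.log 2 n + 1)) := by
  classical
  set L := Nat.log 2 n with hL
  set r := 2 * (L + 1) with hr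
  set N := n - r - 1 with hN
  have hNr : n - N = r + 1 := by omega
  -- the bad set
  set SatR : List (Finset (Fin n) × Bool) → (Fin n → Bool) → Prop :=
    fun E x => ∀ e ∈ E, rowParity e.1 x = e.2 with hSatR
  set Piece : (Fin N → Finset (Fin n) × Bool) → Bool → Finset ((Fin n → Bool) → Bool) :=
    fun σ b => Finset.univ.filter fun g =>
      (∃ x, SatR (List.ofFn σ) x) ∧ ∀ x, SatR (List.ofFn σ) x → g x = b with hPiece
  set Bad : Finset ((Fin n → Bool) → Bool) :=
    (Finset.univ : Finset (Fin N → Finset (Fin n) × Bool)).biUnion fun σ =>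
      (Finset.univ : Finset Bool).biUnion fun b => Piece σ b with hBad
  -- each piece is small
  have hterm : ∀ (σ : Fin N → Finset (Fin n) × Bool) (b : Bool),
      (Piece σ b).card ≤ 2 ^ (2 ^ n - 2 ^ (r + 1)) := by
    intro σ b
    by_cases hσ : ∃ x, SatR (List.ofFn σ) x
    · set T := Finset.univ.filter (fun x => SatR (List.ofFn σ) x) with hT
      have hTc : 2 ^ (n - (List.ofFn σ).length) ≤ T.card := two_pow_le_card_sol _ hσ
      rw [List.length_ofFn, hNr] at hTc
      calc (Piece σ b).card
          ≤ (Finset.univ.filter fun g : (Fin n → Bool) → Bool => ∀ x ∈ T, g x = b).card := by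
            apply Finset.card_le_card
            intro g hg
            simp only [hPiece, Finset.mem_filter, Finset.mem_univ, true_and, hT] at hg ⊢
            intro x hx
            exact hg.2 x hx
        _ ≤ 2 ^ (2 ^ n - T.card) := card_const_on_le T b
        _ ≤ 2 ^ (2 ^ n - 2 ^ (r + 1)) := Nat.pow_le_pow_right (by norm_num) (by omega)
    · have : Piece σ b = ∅ := by
        rw [hPiece]
        apply Finset.filter_eq_empty_iff.mpr
        intro g _ h
        exact hσ h.1
      rw [this]; simp
  -- the bad set is not everything
  have hlog : n < 2 ^ (L + 1) := Nat.lt_pow_succ_log_self one_lt_two n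
  have hcardσ : Fintype.card (Fin N → Finset (Fin n) × Bool) = 2 ^ ((n + 1) * N) := by
    rw [Fintype.card_fun, Fintype.card_prod, Fintype.card_finset, Fintype.card_bool,
      Fintype.card_fin, Fintype.card_fin, ← pow_succ, ← pow_mul]
  have hexp : (n + 1) * N + 1 < 2 ^ (r + 1) := by
    have hN3 : N + 3 ≤ n := by omega
    have h1 : (n + 1) * N + 2 ≤ n * n := by nlinarith [Nat.mul_le_mul_left (n + 1) hN3]
    have h2 : n * n < 2 ^ (L + 1) * 2 ^ (L + 1) := Nat.mul_lt_mul'' hlog hlog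
    have h3 : 2 ^ (L + 1) * 2 ^ (L + 1) ≤ 2 ^ (r + 1) := by
      rw [← pow_add]; exact Nat.pow_le_pow_right (by norm_num) (by omega)
    exact lt_of_lt_of_le (lt_of_lt_of_le (Nat.lt_succ_of_le le_rfl) h1) (le_trans h2.le h3) |>.trans_le le_rfl
  have hpow : 2 ^ (r + 1) ≤ 2 ^ n := Nat.pow_le_pow_right (by norm_num) hrn
  have hA : 2 ^ (2 ^ n) = 2 ^ (2 ^ (r + 1)) * 2 ^ (2 ^ n - 2 ^ (r + 1)) := by
    rw [← pow_add]; congr 1; omega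
  have hone : 1 ≤ 2 ^ (r + 1) := Nat.one_le_two_pow
  have hBadle : Bad.card ≤ 2 ^ (2 ^ n - 1) := by
    calc Bad.card ≤ ∑ σ : Fin N → Finset (Fin n) × Bool, ∑ b : Bool, (Piece σ b).card := by
            refine Finset.card_biUnion_le.trans ?_
            apply Finset.sum_le_sum; intro σ _; exact Finset.card_biUnion_le
      _ ≤ ∑ σ : Fin N → Finset (Fin n) × Bool, ∑ b : Bool, 2 ^ (2 ^ n - 2 ^ (r + 1)) := by
            apply Finset.sum_le_sum; intro σ _; apply Finset.sum_le_sum; intro b _; exact hterm σ b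
      _ = 2 ^ ((n + 1) * N) * (2 * 2 ^ (2 ^ n - 2 ^ (r + 1))) := by
            simp only [Finset.sum_const, Finset.card_univ, hcardσ, Fintype.card_bool, smul_eq_mul]
      _ = 2 ^ ((n + 1) * N + 1) * 2 ^ (2 ^ n - 2 ^ (r + 1)) := by ring
      _ ≤ 2 ^ (2 ^ (r + 1) - 1) * 2 ^ (2 ^ n - 2 ^ (r + 1)) :=
            Nat.mul_le_mul_right _ (Nat.pow_le_pow_right (by norm_num) (by omega))
      _ = 2 ^ (2 ^ n - 1) := by rw [← pow_add]; congr 1; omega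
  refine ⟨Bad, hBadle, fun g hg => ?_⟩
  intro E hE hsat β
  by_contra hc
  push Not at hc
  apply hg
  -- pad `E` to length `N`
  let σ : Fin N → Finset (Fin n) × Bool :=
    fun t => if h : t.val < E.length then E[t.val] else (∅, false)
  have hiff : ∀ x, SatR (List.ofFn σ) x ↔ ∀ e ∈ E, rowParity e.1 x = e.2 := by
    intro x
    simp only [hSatR]
    constructor
    · intro h e he
      obtain ⟨i, hi, rfl⟩ := List.mem_iff_getElem.1 he
      have ht : (⟨i, by omega⟩ : Fin N).val < E.length := hi
      have := h (σ ⟨i, by omega⟩) (List.mem_ofFn.2 ⟨_, rfl⟩)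
      simp only [σ, dif_pos hi] at this
      exact this
    · intro h e' he'
      obtain ⟨t, rfl⟩ := List.mem_ofFn.1 he'
      by_cases ht : t.val < E.length
      · simp only [σ, dif_pos ht]
        exact h _ (List.getElem_mem ht)
      · simp [σ, dif_neg ht, rowParity]
  simp only [hBad, Finset.mem_biUnion, Finset.mem_univ, true_and]
  refine ⟨σ, !β, ?_⟩
  simp only [hPiece, Finset.mem_filter, Finset.mem_univ, true_and]
  refine ⟨?_, fun x hx => ?_⟩
  · obtain ⟨x, hx⟩ := hsat
    exact ⟨x, (hiff x).2 hx⟩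
  · have := hc x ((hiff x).1 hx)
    revert this
    cases g x <;> cases β <;> simp

/-- Functions of `B₂`-circuit complexity `≤ S` are decodings of codes: at most `#Code(n,S)` of them. -/
theorem card_easy_le_card_code (n S : ℕ) :
    (Finset.univ.filter fun g : (Fin n → Bool) → Bool => circuitSizeOver B2 g ≤ S).card
      ≤ Fintype.card (CircuitCount.Code n S) := by
  classical
  calc (Finset.univ.filter fun g : (Fin n → Bool) → Bool => circuitSizeOver B2 g ≤ S).card
      ≤ (Finset.univ.image fun c : CircuitCount.Code n S => CircuitCount.decode c).card := by
        apply Finset.card_le_card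
        intro g hg
        simp only [Finset.mem_filter, Finset.mem_univ, true_and] at hg
        obtain ⟨C, hB, hC, hsize⟩ := exists_computes_B2_size_eq_holds g
        obtain ⟨c, hc⟩ := CircuitCount.exists_code C hB (hsize ▸ hg)
        refine Finset.mem_image.2 ⟨c, Finset.mem_univ _, ?_⟩
        rw [hc]; funext x; exact hC x
    _ ≤ Fintype.card (CircuitCount.Code n S) := Finset.card_image_le.trans (by rw [Finset.card_univ])

/-- `⌊log₂ n⌋ + 6 ≤ n` for `n ≥ 9` (the tree's private `log_two_add_six_le`, restated). -/
theorem log_two_add_six_le {n : ℕ} (hn : 9 ≤ n) : Nat.log 2 n + 6 ≤ n := by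
  have key : ∀ m : ℕ, 9 + m < 2 ^ (m + 4) := by
    intro m
    induction m with
    | zero => norm_num
    | succ m ih => rw [pow_succ]; omega
  obtain ⟨m, rfl⟩ : ∃ m, n = 9 + m := ⟨n - 9, by omega⟩
  have hlt : Nat.log 2 (9 + m) < m + 4 := Nat.log_lt_of_lt_pow (by omega) (key m)
  omega

/-- **Riordan–Shannon, one exponent sharper than the tree states it**: for `n ≥ 9` and
`S + 2 = 2^{n − ⌊log₂ n⌋ − 4}`, `#Code(n,S) < 2^{2^{n−1}}` (same proof as
`card_code_lt_two_pow_two_pow`, which discards the last factor of two). -/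
theorem card_code_lt_two_pow_two_pow_pred {n S : ℕ} (hn : 9 ≤ n)
    (hS : S + 2 = 2 ^ (n - (Nat.log 2 n + 4))) :
    Fintype.card (CircuitCount.Code n S) < 2 ^ 2 ^ (n - 1) := by
  set t := Nat.log 2 n + 4 with ht
  have htn : t + 2 ≤ n := by have := log_two_add_six_le hn; omega
  set M := n + S + 1 with hM
  have h16 : (S + 1) * M ≤ 16 * M ^ 2 := by nlinarith
  have hcard : Fintype.card (CircuitCount.Code n S) ≤ (16 * M ^ 2) ^ (S + 1) := by
    calc Fintype.card (CircuitCount.Code n S)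
        ≤ (S + 1) * (16 * M ^ 2) ^ S * M := CircuitCount.card_code_le n S
      _ = (16 * M ^ 2) ^ S * ((S + 1) * M) := by ring
      _ ≤ (16 * M ^ 2) ^ S * (16 * M ^ 2) := Nat.mul_le_mul_left _ h16
      _ = (16 * M ^ 2) ^ (S + 1) := by ring
  have hS1 : S + 2 ≤ 2 ^ (n - 1) := by
    rw [hS]; exact Nat.pow_le_pow_right (by norm_num) (by omega)
  have hMle : M ≤ 2 ^ n := by
    have h2 : 2 ^ n = 2 * 2 ^ (n - 1) := by
      rw [← pow_succ']; congr 1; omega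
    have hn1 : n ≤ 2 ^ (n - 1) := by
      have := Nat.lt_two_pow_self (n := n - 1)
      omega
    omega
  have h16M : 16 * M ^ 2 ≤ 2 ^ (2 * n + 4) := by
    have : 2 ^ (2 * n + 4) = 16 * (2 ^ n) ^ 2 := by ring
    rw [this]
    gcongr
  have hlog : n < 2 ^ (Nat.log 2 n + 1) := Nat.lt_pow_succ_log_self (by norm_num) n
  have h2n4 : 2 * n + 4 ≤ 2 ^ (t - 1) := by
    have : 2 ^ (t - 1) = 4 * 2 ^ (Nat.log 2 n + 1) := by
      rw [ht, show Nat.log 2 n + 4 - 1 = (Nat.log 2 n + 1) + 2 by omega, pow_add]; ring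
    omega
  have hexp : (2 * n + 4) * (S + 1) < 2 ^ (n - 1) := by
    have hS' : S + 1 < 2 ^ (n - t) := by omega
    calc (2 * n + 4) * (S + 1) ≤ 2 ^ (t - 1) * (S + 1) := Nat.mul_le_mul_right _ h2n4
      _ < 2 ^ (t - 1) * 2 ^ (n - t) := Nat.mul_lt_mul_of_pos_left hS' (by positivity)
      _ = 2 ^ (n - 1) := by rw [← pow_add]; congr 1; omega
  calc Fintype.card (CircuitCount.Code n S) ≤ (16 * M ^ 2) ^ (S + 1) := hcard
    _ ≤ (2 ^ (2 * n + 4)) ^ (S + 1) := Nat.pow_le_pow_left h16M _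
    _ = 2 ^ ((2 * n + 4) * (S + 1)) := by rw [← pow_mul]
    _ < 2 ^ 2 ^ (n - 1) := Nat.pow_lt_pow_right (by norm_num) hexp

theorem two_mul_add_three_le_two_pow {L : ℕ} (h : 4 ≤ L) : 2 * L + 3 ≤ 2 ^ L := by
  induction L, h using Nat.le_induction with
  | base => norm_num
  | succ L hL ih =>
    have : 1 ≤ 2 ^ L := Nat.one_le_two_pow
    rw [pow_succ]; omega

/-- **S0 holds**: for every `n ≥ 1` there is a non-constant `g : {0,1}^n → {0,1}` which is
`2 (log₂ n + 1)`-affine-generic (`AffGeneric`, L⁺'s hypothesis) AND whose Karchmer–Wigderson game has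
protocol depth `≥ n − 8 (log₂ n + 1)` (M3's hypothesis) — the joint inner function the LRAD adversary needs. -/
theorem jointHardGeneric_exists : ∃ c : ℕ, ∀ n : ℕ, 1 ≤ n → ∃ g : (Fin n → Bool) → Bool,
    (∃ u v, g u = true ∧ g v = false) ∧ AffGeneric g (2 * (Nat.log 2 n + 1)) ∧
    ∀ P : Literature.Computability.Complexity.KWTree (Fin n), P.Solves g →
      n ≤ P.depth + c * (Nat.log 2 n + 1) := by
  classical
  refine ⟨8, fun n hn => ?_⟩
  have hlog : n < 2 ^ (Nat.log 2 n + 1) := Nat.lt_pow_succ_log_self one_lt_two n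
  by_cases hsmall : n ≤ 8
  · -- small `n`: a dictator; genericity only has to handle the empty system
    have hL : n ≤ 2 * Nat.log 2 n + 3 := by
      rcases Nat.lt_or_ge (Nat.log 2 n) 3 with h3 | h3
      · generalize hLn : Nat.log 2 n = L at hlog h3 ⊢
        interval_cases L <;> simp at hlog <;> omega
      · omega
    refine ⟨fun x => x ⟨0, by omega⟩, ⟨fun _ => true, fun _ => false, rfl, rfl⟩, ?_, ?_⟩
    · intro E hE hsat β
      have hE0 : E = [] := List.eq_nil_of_length_eq_zero (by omega)
      subst hE0
      exact ⟨fun _ => β, fun e he => by simp at he, rfl⟩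
    · intro P _
      have := Nat.zero_le P.depth
      nlinarith [Nat.zero_le (Nat.log 2 n)]
  have hn9 : 9 ≤ n := by omega
  set L := Nat.log 2 n with hLdef
  have hL3 : 3 ≤ L := by
    by_contra h
    have : 2 ^ (L + 1) ≤ 2 ^ 3 := Nat.pow_le_pow_right (by norm_num) (by omega)
    omega
  have hpowL : 2 ^ L ≤ n := by rw [hLdef]; exact Nat.pow_log_le_self 2 (by omega)
  have hrn : 2 * (L + 1) + 1 ≤ n := by
    rcases eq_or_lt_of_le hL3 with h | h
    · omega
    · have := two_mul_add_three_le_two_pow (L := L) (by omega)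
      omega
  -- the two bad sets
  obtain ⟨Bad, hBad, hgenBad⟩ := exists_affBad (n := n) (by rw [← hLdef]; exact hrn)
  set t := L + 4 with ht
  have htn : t + 2 ≤ n := by have := log_two_add_six_le hn9; omega
  have hpow2 : 4 ≤ 2 ^ (n - t) := by
    calc (4 : ℕ) = 2 ^ 2 := by norm_num
      _ ≤ 2 ^ (n - t) := Nat.pow_le_pow_right (by norm_num) (by omega)
  set S := 2 ^ (n - t) - 2 with hSdef
  have hS : S + 2 = 2 ^ (n - (Nat.log 2 n + 4)) := by rw [← hLdef, ← ht]; omega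
  set Easy : Finset ((Fin n → Bool) → Bool) :=
    Finset.univ.filter fun g => circuitSizeOver B2 g ≤ S with hEasy
  have hEasylt : Easy.card < 2 ^ 2 ^ (n - 1) :=
    (card_easy_le_card_code n S).trans_lt (card_code_lt_two_pow_two_pow_pred hn9 hS)
  have hhalf : 2 ^ 2 ^ (n - 1) ≤ 2 ^ (2 ^ n - 1) := by
    apply Nat.pow_le_pow_right (by norm_num)
    have h2 : 2 ^ n = 2 * 2 ^ (n - 1) := by rw [← pow_succ']; congr 1; omega
    have : 1 ≤ 2 ^ (n - 1) := Nat.one_le_two_pow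
    omega
  have h2n : 1 ≤ 2 ^ n := Nat.one_le_two_pow
  have huniv : (Finset.univ : Finset ((Fin n → Bool) → Bool)).card = 2 ^ (2 ^ n) := by
    simp [Finset.card_univ, Fintype.card_bool, Fintype.card_fin]
  have hunion : (Easy ∪ Bad).card < (Finset.univ : Finset ((Fin n → Bool) → Bool)).card := by
    rw [huniv]
    calc (Easy ∪ Bad).card ≤ Easy.card + Bad.card := Finset.card_union_le _ _
      _ < 2 ^ (2 ^ n - 1) + 2 ^ (2 ^ n - 1) := by omega
      _ = 2 ^ (2 ^ n) := by rw [← two_mul, ← pow_succ']; congr 1; omega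
  obtain ⟨g, -, hg⟩ := Finset.exists_mem_notMem_of_card_lt_card hunion
  rw [Finset.mem_union, not_or] at hg
  have hlt : S < circuitSizeOver B2 g := by
    have := hg.1
    simp only [hEasy, Finset.mem_filter, Finset.mem_univ, true_and, not_le] at this
    exact this
  -- `g` is not constant: constants have circuits of size `1 ≤ S`
  have hS2 : 2 ≤ S := by omega
  have hne : (∃ a, g a = true) ∧ ∃ b, g b = false := by
    by_contra hcon
    have hconst : ∃ b : Bool, g = fun _ => b := by
      by_cases h1 : ∃ a, g a = true
      · refine ⟨true, funext fun x => ?_⟩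
        by_contra hx
        exact hcon ⟨h1, x, by simpa using hx⟩
      · refine ⟨false, funext fun x => ?_⟩
        by_contra hx
        exact h1 ⟨x, by simpa using hx⟩
    obtain ⟨b, hb⟩ := hconst
    have h1 : circuitSizeOver B2 g ≤ 1 := by rw [hb]; exact circuitSizeOver_B2_const_le _ b
    omega
  refine ⟨g, ?_, hgenBad g hg.2, fun P hP => ?_⟩
  · obtain ⟨⟨a, ha⟩, ⟨b, hb⟩⟩ := hne
    exact ⟨a, b, ha, hb⟩
  · have hdepth := P.circuitSizeOver_B2_lt_two_pow_of_solves hP hne.1 hne.2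
    have hle : 2 ^ (n - t) ≤ 2 ^ (P.depth + 1) := by omega
    have hnt : n - t ≤ P.depth + 1 := (Nat.pow_le_pow_iff_right (by norm_num)).mp hle
    omega

end JointExistence

/-! ## §7 The rung C1|LRAD reduced to ONE adversary statement (skeleton; every other piece proved here)

`LRADQuantitative` is the quantitative adversary bound the gluing of memo §5 should deliver (card
`row-typing-discipline`, First lemma, with the per-row hypothesis `PerRowLU` that §5 proves available):
label hardness `ℓ`, KW-depth `dg` of `g`, per-row affine budget `q`; every disciplined protocol for the
strong game has depth `≥ ℓ + min(dg, q − 1) − 2`.  `strongCompositionLRAD_of_quantitative` assembles the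
class statement `StrongCompositionLRAD` from it ALONE, using §5 (`perRowLUOfGeneric_holds`), §6
(`jointHardGeneric_exists`) and the tree's `liftRows` embedding for the budget-free small-`n` case. -/
section Assembly

/-- **The one remaining stub of the LRAD rung** (an adversary theorem; memo §5.3 is its step table).
Non-constancy of `f` is load-bearing (for constant `f` the leaf protocol solves the strong game vacuously,
cf. the disprover's `strongComposition_false_without_nonconst`); constant `g` forces `dg = 0`. -/
def LRADQuantitative : Prop :=
  ∀ (m n q dg ℓ : ℕ) (f : (Fin m → Bool) → Bool) (g : (Fin n → Bool) → Bool),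
    (∃ a b, f a = true ∧ f b = false) →
    (∀ R : KWTree (Fin n), R.Solves g → dg ≤ R.depth) → PerRowLU g m q → 1 ≤ q →
    Hard (f ⁻¹' {true}) (f ⁻¹' {false}) ℓ →
    ∀ P : KWTree (Fin m × Fin n), LRADisciplined g P → P.SolvesStrong f g →
      ℓ + min dg (q - 1) ≤ P.depth + 2

/-- **Assembly of the rung**: the adversary bound alone gives C1 on the disciplined class, with loss
`(c + 8) (log₂ (m n) + 1)` where `c` is the constant of `jointHardGeneric_exists`. -/
theorem strongCompositionLRAD_of_quantitative (hQ : LRADQuantitative) : StrongCompositionLRAD := by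
  obtain ⟨c, hc⟩ := jointHardGeneric_exists
  refine ⟨c + 8, fun m n hn f hf => ?_⟩
  obtain ⟨g, ⟨u, v, hu, hv⟩, hgen, hdepth⟩ := hc n hn
  refine ⟨g, fun P hP hsol => ?_⟩
  have hne : ∃ a b, f a = true ∧ f b = false := by
    obtain ⟨a, b, hab⟩ := hf
    cases ha : f a <;> cases hb : f b
    · rw [ha, hb] at hab; exact absurd rfl hab
    · exact ⟨b, a, hb, ha⟩
    · exact ⟨a, b, ha, hb⟩
    · rw [ha, hb] at hab; exact absurd rfl hab
  have hm : 0 < m := by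
    obtain ⟨a, b, hab⟩ := hf
    rcases Nat.eq_zero_or_pos m with h0 | h0
    · exfalso; subst h0; exact hab (congrArg f (funext fun i => i.elim0))
    · exact h0
  set L := Nat.log 2 (m * n) + 1 with hL
  have hLn : Nat.log 2 n + 1 ≤ L := by
    have : Nat.log 2 n ≤ Nat.log 2 (m * n) := Nat.log_mono_right (Nat.le_mul_of_pos_left n hm)
    omega
  set r := 2 * (Nat.log 2 n + 1) with hr
  set q := n - r - 1 with hq
  have hLU : PerRowLU g m q := perRowLUOfGeneric_holds m n r g ⟨u, v, hu, hv⟩ hgen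
  have e1 : (c + 8) * L = c * L + 8 * L := by ring
  have hcL : c * (Nat.log 2 n + 1) ≤ c * L := Nat.mul_le_mul_left _ hLn
  rcases Nat.eq_zero_or_pos q with hq0 | hq0
  · -- no affine budget (`n ≤ 2 log₂ n + 3`): the `liftRows` protocol already fits
    refine ⟨P.comap (KWTree.liftRows u v) (KWTree.liftRows u v) Prod.fst, KWTree.solves_comap_liftRows hsol hu hv, ?_⟩
    rw [KWTree.depth_comap]
    omega
  · set dg := n - c * (Nat.log 2 n + 1) with hdg
    have hKW : ∀ R : KWTree (Fin n), R.Solves g → dg ≤ R.depth := fun R hR => by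
      have := hdepth R hR; omega
    by_contra hcon
    push Not at hcon
    set ℓ := P.depth + (c + 8) * L + 1 - n with hℓ
    have hH : Hard (f ⁻¹' {true}) (f ⁻¹' {false}) ℓ := by
      intro Q hQ
      have hs : Q.Solves f := fun a b ha hb => hQ a (by simpa using ha) b (by simpa using hb)
      have := hcon Q hs
      omega
    have hmain := hQ m n q dg ℓ f g hne hKW hLU hq0 hH P hP hsol
    omega

end Assembly

end Summit.PneNP.PneNP.Cruxes.StrongComposition.P4g19
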